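import Literature.Analysis.FluidPDE.PassiveScalarForcedClassicalEntropy
import Literature.Analysis.FluidPDE.PassiveScalarGradientTransport
import Literature.Analysis.FluidPDE.PassiveScalarVelocityStability
import HarnessLib

/-!
# Gradient and Hessian growth for the forced transport–diffusion equation on `T^d`,
# uniformly in the diffusivity

Analysis/FluidPDE proof file (theorems only; no definitions, no named facts). For a classical
solution of the forced passive scalar equation `∂ₜθ + u·∇θ = κΔθ + s`, `div u = 0`, on a time window
`[a, b] × T^d` (tree predicate `Torus.IsClassicalScalarTransportForcedOn`, clauses unbundled there),
with `κ ≥ 0`: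

* `IsClassicalScalarTransportForcedOn.partialDeriv` — **the differentiated equation is again a forced
  transport–diffusion equation**: `∂ₖθ` solves `∂ₜ(∂ₖθ) + u·∇(∂ₖθ) = κΔ(∂ₖθ) + (∂ₖs − ⟪∂ₖu, ∇θ⟫)`
  (Evans 2010, §7.1.3, proof of Thm. 5: differentiate the equation in `xₖ`; the unforced tree twin is
  `IsClassicalScalarTransportOn.partialDeriv_transport`);
* `….sqrt_integral_sq_le` / `….sqrt_integral_sq_le_exp` — **`L²` level**: if `‖s(τ)‖₂ ≤ G(τ)`, resp.
  `‖s(τ)‖₂ ≤ Λ‖θ(τ)‖₂ + G(τ)`, then `‖θ(t)‖₂ ≤ ‖θ(a)‖₂ + ∫ₐᵗ G`, resp.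
  `‖θ(t)‖₂ ≤ e^{Λ(t−a)}(‖θ(a)‖₂ + ∫ₐᵗ G)` — the balance `d/dt‖θ‖₂² = −2κ‖∇θ‖₂² + 2∫θs ≤ 2‖θ‖₂‖s‖₂`
  (DiPerna–Lions renormalisation with `β(r) = r²`, tree
  `IsClassicalScalarTransportForcedOn.hasDerivWithinAt_integral_comp`) and a comparison lemma;
* `….sqrt_scalarGradNormSq_le_exp` — **`H¹` level, uniformly in `κ ≥ 0`**: if `‖∂ₖu(τ, x)‖ ≤ Λ` on the
  window and `‖∇s(τ)‖₂ ≤ G(τ)`, then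
  `‖∇θ(t)‖₂ ≤ e^{dΛ(t−a)} (‖∇θ(a)‖₂ + ∫ₐᵗ G)` (`d = card d`): sum the `L²` balances of the `∂ₖθ`, bound
  the production `−∑ₖ ∂ₖθ ⟪∂ₖu, ∇θ⟫ ≤ dΛ‖∇θ‖²` pointwise, Cauchy–Schwarz, weighted comparison;
* `….sqrt_hessSq_le_exp` — **`H²` level, uniformly in `κ ≥ 0`**: with in addition `‖∂ᵢ∂ₖu‖ ≤ L₂`,
  `‖∇θ(τ)‖₂ ≤ Y(τ)` and `(∑ᵢₖ‖∂ᵢ∂ₖs(τ)‖₂²)^{1/2} ≤ G(τ)`,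
  `(∑ᵢₖ‖∂ᵢ∂ₖθ(t)‖₂²)^{1/2} ≤ e^{2d²Λ(t−a)} ((∑ᵢₖ‖∂ᵢ∂ₖθ(a)‖₂²)^{1/2} + ∫ₐᵗ (d²L₂Y + G))`
  (differentiate twice, same mechanism; the second-order production is
  `∂ᵢ∂ₖs − ⟪∂ᵢ∂ₖu, ∇θ⟫ − ⟪∂ₖu, ∇∂ᵢθ⟫ − ⟪∂ᵢu, ∇∂ₖθ⟫`).

These are the linear (given drift) instances of the `H^m` energy estimate "uniform in the viscosity"
of Majda–Bertozzi 2002, §3.2 Prop. 3.7 / (3.58)–(3.60) (there for the Navier–Stokes and Euler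
equations simultaneously; here the drift is prescribed, so no calculus inequality is needed and the
constants are the displayed polynomials in the sup norms of `∇u`, `∇²u`). No `κ⁻¹` appears: the
diffusion is dropped with its sign, never used to absorb the production (contrast the tree's
`Torus.linearisedNS_gradNormSq_laplacian_flux_le`, which pays the `H³` flux of the linearised
Navier–Stokes equation with `ν⁻¹`). Written for the vorticity `ω = curl w` of the planar linearised
Navier–Stokes flow, which is such a forced scalar (tree
`Torus.linearisedNSForced_isClassicalScalarTransportForcedOn_vorticity_fin_two`, source
`curl g − ⟪w, ∇Ω̄⟫`), where `‖∇ω‖₂ = ‖Δw‖₂` and `‖∇²ω‖₂` controls `‖∇Δw‖₂` — the quantity inside the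
logarithm of the Beale–Kato–Majda gradient bound (tree `Torus.exists_sqrt_gradSq_le_bkm_log_fin_two`).

## Mathlib / tree search

Tree (reused): `IsClassicalScalarTransportForcedOn.hasDerivWithinAt_integral_comp`, `.restrict_Icc`
(`PassiveScalarForcedClassicalEntropy`); `IsClassicalScalarTransportOn.partialDeriv_transport` (pattern,
`PassiveScalarGradientTransport`); `Torus.sqrt_le_sqrt_add_integral_of_hasDerivWithinAt`
(`PassiveScalarVelocityStability`); `Torus.integral_mul_le_sqrt_mul_sqrt` (`TorusDiffMonomialBounds`);
`norm_gradient_sq_eq_sum` (`PassiveScalarClassicalEnergy`); `Torus.partialDeriv_add/_inner/_const_smul`,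
`partialDeriv_gradient_comm`, `partialDeriv_laplacian_comm`, `timeDerivWithin_partialDeriv_comm`,
`IsSmoothSpaceTimeOn.partialDeriv/.gradient/.inner/.sub/.mul/.hasDerivWithinAt_integral/.continuousOn_integral`.
Searched `ScalarTransportForcedOn.*partialDeriv`, `scalarGradNormSq_le_exp`, `hess.*TransportForced`: nothing.

## References

* A. J. Majda, A. L. Bertozzi, *Vorticity and Incompressible Flow*, CUP 2002, §3.2 Prop. 3.7,
  (3.58)–(3.60) (the `H^m` energy estimate, uniform in `ν`). [MajdaBertozzi2002]
* L. C. Evans, *Partial Differential Equations*, 2nd ed., AMS 2010, §7.1.3 Thm. 5 (proof: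
  differentiate the equation), §7.1.2 Thm. 2 (energy estimates). [Evans2010]
* R. J. DiPerna, P.-L. Lions, Invent. Math. 98 (1989), §II.3 (renormalisation). [DiPernaLions1989Invent]
-/

noncomputable section

open Set MeasureTheory Finset
open scoped ContDiff InnerProductSpace RealInnerProductSpace

namespace Literature.Analysis.FluidPDE

namespace Torus

open Literature.Analysis.FunctionSpaces
open Literature.Analysis.FunctionSpaces.Torus

variable {d : Type*} [Fintype d] [DecidableEq d]

/-! ### Two comparison lemmas on a window `[a, t]` -/

namespace ForcedGradientGrowth

omit [Fintype d] [DecidableEq d] in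
/-- Comparison lemma on `[a, t]` (time-translate of the tree's
`Torus.sqrt_le_sqrt_add_integral_of_hasDerivWithinAt` on `[0, T]`): `φ ≥ 0` with continuous
one-sided derivative `D ≤ 2√φ·G`, `G ≥ 0` continuous, gives `√(φ(t)) ≤ √(φ(a)) + ∫ₐᵗ G`.
[cite: Evans2010, App. B.2 j (Gronwall's inequality, differential form; zero linear coefficient)] -/
theorem sqrt_le_sqrt_add_integral_Icc {φ D G : ℝ → ℝ} {a t : ℝ} (hat : a ≤ t)
    (hφ : ∀ τ ∈ Icc a t, HasDerivWithinAt φ (D τ) (Icc a t) τ) (hD : ContinuousOn D (Icc a t))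
    (hpos : ∀ τ ∈ Icc a t, 0 ≤ φ τ) (hle : ∀ τ ∈ Icc a t, D τ ≤ 2 * Real.sqrt (φ τ) * G τ)
    (hG0 : ∀ τ ∈ Icc a t, 0 ≤ G τ) (hG : ContinuousOn G (Icc a t)) :
    Real.sqrt (φ t) ≤ Real.sqrt (φ a) + ∫ τ in a..t, G τ := by
  set T : ℝ := t - a with hT
  have hT0 : 0 ≤ T := by rw [hT]; linarith
  have hmaps : MapsTo (fun σ : ℝ => a + σ) (Icc (0 : ℝ) T) (Icc a t) := by
    intro σ hσ
    exact ⟨by linarith [hσ.1], by rw [hT] at hσ; linarith [hσ.2]⟩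
  have hsh : ∀ σ : ℝ, HasDerivWithinAt (fun σ : ℝ => a + σ) 1 (Icc (0 : ℝ) T) σ := fun σ =>
    ((hasDerivAt_id σ).const_add a).hasDerivWithinAt
  have hcsh : ContinuousOn (fun σ : ℝ => a + σ) (Icc (0 : ℝ) T) :=
    (continuous_const.add continuous_id).continuousOn
  have hφ' : ∀ σ ∈ Icc (0 : ℝ) T, HasDerivWithinAt (fun σ => φ (a + σ)) (D (a + σ)) (Icc 0 T) σ := by
    intro σ hσ
    have h := (hφ (a + σ) (hmaps hσ)).comp σ (hsh σ) hmaps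
    simpa only [mul_one, Function.comp_def] using h
  have hD' : ContinuousOn (fun σ => D (a + σ)) (Icc (0 : ℝ) T) := hD.comp hcsh hmaps
  have hG' : ContinuousOn (fun σ => G (a + σ)) (Icc (0 : ℝ) T) := hG.comp hcsh hmaps
  have key := Torus.sqrt_le_sqrt_add_integral_of_hasDerivWithinAt (φ := fun σ => φ (a + σ))
    (D := fun σ => D (a + σ)) (g := fun σ => G (a + σ)) hT0 hφ' hD'
    (fun σ hσ => hpos _ (hmaps hσ)) (fun σ hσ => hle _ (hmaps hσ)) (fun σ hσ => hG0 _ (hmaps hσ))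
    (hG'.intervalIntegrable_of_Icc hT0)
  have e1 : a + T = t := by rw [hT]; ring
  simp only [add_zero, e1] at key
  rw [intervalIntegral.integral_comp_add_left (fun τ => G τ) a, add_zero, e1] at key
  exact key

omit [Fintype d] [DecidableEq d] in
/-- **Weighted comparison lemma (Grönwall form).** `φ ≥ 0` with continuous one-sided derivative
`D ≤ 2√φ (Λ√φ + G)` on `[a, t]`, `Λ ≥ 0`, `G ≥ 0` continuous, gives
`√(φ(t)) ≤ e^{Λ(t−a)} (√(φ(a)) + ∫ₐᵗ G)`: apply the comparison lemma to `e^{−2Λ(τ−a)} φ`, whose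
derivative is at most `2 √(e^{−2Λ(τ−a)}φ) · e^{−Λ(τ−a)} G ≤ 2 √(e^{−2Λ(τ−a)}φ) · G`.
[cite: Evans2010, App. B.2 j (Gronwall's inequality, differential form)] -/
theorem sqrt_le_exp_mul_Icc {φ D G : ℝ → ℝ} {a t Λ : ℝ} (hat : a ≤ t) (hΛ : 0 ≤ Λ)
    (hφ : ∀ τ ∈ Icc a t, HasDerivWithinAt φ (D τ) (Icc a t) τ) (hD : ContinuousOn D (Icc a t))
    (hpos : ∀ τ ∈ Icc a t, 0 ≤ φ τ)
    (hle : ∀ τ ∈ Icc a t, D τ ≤ 2 * Real.sqrt (φ τ) * (Λ * Real.sqrt (φ τ) + G τ))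
    (hG0 : ∀ τ ∈ Icc a t, 0 ≤ G τ) (hG : ContinuousOn G (Icc a t)) :
    Real.sqrt (φ t) ≤ Real.exp (Λ * (t - a)) * (Real.sqrt (φ a) + ∫ τ in a..t, G τ) := by
  -- the weight `w(τ) = e^{-Λ(τ - a)}` and the weighted energy `ψ = w² φ`
  set w : ℝ → ℝ := fun τ => Real.exp (-(Λ * (τ - a))) with hw
  have hwpos : ∀ τ, 0 < w τ := fun τ => Real.exp_pos _
  have hwd : ∀ τ, HasDerivAt w (-Λ * w τ) τ := by
    intro τ
    have h0 : HasDerivAt (fun τ : ℝ => Λ * (τ - a)) (Λ * 1) τ :=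
      ((hasDerivAt_id τ).sub_const a).const_mul Λ
    have h1 : HasDerivAt (fun τ : ℝ => -(Λ * (τ - a))) (-(Λ * 1)) τ := h0.neg
    rw [mul_one] at h1
    have h2 := h1.exp
    have e : Real.exp (-(Λ * (τ - a))) * -Λ = -Λ * w τ := by rw [hw]; ring
    rw [e] at h2
    exact h2
  have hwle : ∀ τ ∈ Icc a t, w τ ≤ 1 := by
    intro τ hτ
    rw [hw]
    have : -(Λ * (τ - a)) ≤ 0 := by
      have : 0 ≤ Λ * (τ - a) := mul_nonneg hΛ (by linarith [hτ.1])
      linarith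
    exact Real.exp_le_one_iff.mpr this
  set ψ : ℝ → ℝ := fun τ => w τ * w τ * φ τ with hψ
  set Dψ : ℝ → ℝ := fun τ => (-Λ * w τ * w τ + w τ * (-Λ * w τ)) * φ τ + w τ * w τ * D τ with hDψ
  have hψd : ∀ τ ∈ Icc a t, HasDerivWithinAt ψ (Dψ τ) (Icc a t) τ := by
    intro τ hτ
    have h1 : HasDerivWithinAt (fun τ => w τ * w τ) (-Λ * w τ * w τ + w τ * (-Λ * w τ)) (Icc a t) τ :=
      ((hwd τ).mul (hwd τ)).hasDerivWithinAt
    exact h1.mul (hφ τ hτ)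
  have hwc : Continuous w := by
    rw [hw]; fun_prop
  have hDψc : ContinuousOn Dψ (Icc a t) := by
    have hφc : ContinuousOn φ (Icc a t) := fun τ hτ => (hφ τ hτ).continuousWithinAt
    have hwo : ContinuousOn w (Icc a t) := hwc.continuousOn
    have c1 : ContinuousOn (fun τ => (-Λ * w τ * w τ + w τ * (-Λ * w τ)) * φ τ) (Icc a t) :=
      (((continuousOn_const.mul hwo).mul hwo).add (hwo.mul (continuousOn_const.mul hwo))).mul hφc
    have c2 : ContinuousOn (fun τ => w τ * w τ * D τ) (Icc a t) := (hwo.mul hwo).mul hD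
    exact c1.add c2
  have hψpos : ∀ τ ∈ Icc a t, 0 ≤ ψ τ := fun τ hτ => mul_nonneg (mul_self_nonneg _) (hpos τ hτ)
  have hsqrtψ : ∀ τ ∈ Icc a t, Real.sqrt (ψ τ) = w τ * Real.sqrt (φ τ) := by
    intro τ hτ
    rw [hψ]
    dsimp only
    rw [Real.sqrt_mul (mul_self_nonneg _), Real.sqrt_mul_self (hwpos τ).le]
  have hleψ : ∀ τ ∈ Icc a t, Dψ τ ≤ 2 * Real.sqrt (ψ τ) * G τ := by
    intro τ hτ
    rw [hsqrtψ τ hτ, hDψ]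
    dsimp only
    have hφτ := hpos τ hτ
    have hs : Real.sqrt (φ τ) * Real.sqrt (φ τ) = φ τ := Real.mul_self_sqrt hφτ
    have hwτ := hwpos τ
    have hGτ := hG0 τ hτ
    have h1 : w τ * w τ * D τ ≤ w τ * w τ * (2 * Real.sqrt (φ τ) * (Λ * Real.sqrt (φ τ) + G τ)) :=
      mul_le_mul_of_nonneg_left (hle τ hτ) (mul_self_nonneg _)
    have h2 : w τ * w τ * (2 * Real.sqrt (φ τ) * (Λ * Real.sqrt (φ τ) + G τ)) =
        2 * Λ * (w τ * w τ) * φ τ + 2 * (w τ * Real.sqrt (φ τ)) * (w τ * G τ) := by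
      have : w τ * w τ * (2 * Real.sqrt (φ τ) * (Λ * Real.sqrt (φ τ) + G τ)) =
          2 * Λ * (w τ * w τ) * (Real.sqrt (φ τ) * Real.sqrt (φ τ)) +
            2 * (w τ * Real.sqrt (φ τ)) * (w τ * G τ) := by
        ring
      rw [this, hs]
    have h3 : w τ * G τ ≤ G τ := by
      have := mul_le_mul_of_nonneg_right (hwle τ hτ) hGτ
      simpa using this
    have h4 : 2 * (w τ * Real.sqrt (φ τ)) * (w τ * G τ) ≤ 2 * (w τ * Real.sqrt (φ τ)) * G τ :=
      mul_le_mul_of_nonneg_left h3 (by positivity)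
    nlinarith [h1, h2, h4]
  have key := sqrt_le_sqrt_add_integral_Icc hat hψd hDψc hψpos hleψ hG0 hG
  have hwa : w a = 1 := by rw [hw]; simp
  rw [hsqrtψ t (right_mem_Icc.mpr hat), hsqrtψ a (left_mem_Icc.mpr hat), hwa, one_mul] at key
  -- unweight: `√φ(t) = e^{Λ(t−a)} · (w t · √φ(t))`
  have hexp : Real.exp (Λ * (t - a)) * w t = 1 := by
    rw [hw]
    dsimp only
    rw [← Real.exp_add]
    simp
  have hpos' : 0 ≤ Real.exp (Λ * (t - a)) := (Real.exp_pos _).le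
  calc Real.sqrt (φ t) = Real.exp (Λ * (t - a)) * (w t * Real.sqrt (φ t)) := by
        rw [← mul_assoc, hexp, one_mul]
    _ ≤ Real.exp (Λ * (t - a)) * (Real.sqrt (φ a) + ∫ τ in a..t, G τ) :=
        mul_le_mul_of_nonneg_left key hpos'

end ForcedGradientGrowth

namespace IsClassicalScalarTransportForcedOn

variable {κ : ℝ} {u : ℝ → UnitAddTorus d → EuclideanSpace ℝ d} {s θ : ℝ → UnitAddTorus d → ℝ}

/-! ### The differentiated equation -/

/-- **The equation for `∂ᵢθ`, forced case.** If `θ` solves `∂ₜθ + u·∇θ = κΔθ + s` classically on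
`[a, b] × T^d` (`a < b`), then for `t ∈ [a, b]`, `x ∈ T^d` and every direction `i`,
`∂ₜ(∂ᵢθ) + ⟪u, ∇(∂ᵢθ)⟫ = κ Δ(∂ᵢθ) + (∂ᵢs − ⟪∂ᵢu, ∇θ⟫)` at `(t, x)` (one-sided time derivative within
`[a, b]`). [cite: Evans2010, §7.1.3 Thm. 5 (proof: differentiate the equation with respect to x_k)] -/
theorem partialDeriv_transport {a b : ℝ} (hab : a < b)
    (h : IsClassicalScalarTransportForcedOn (Icc a b) κ u s θ) (i : d) {t : ℝ} (ht : t ∈ Icc a b)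
    (x : UnitAddTorus d) :
    FunctionSpaces.Torus.timeDerivWithin (Icc a b) (fun τ => FunctionSpaces.Torus.partialDeriv i (θ τ)) t x +
        ⟪u t x, FunctionSpaces.Torus.gradient (FunctionSpaces.Torus.partialDeriv i (θ t)) x⟫_ℝ =
      κ * FunctionSpaces.Torus.laplacian (FunctionSpaces.Torus.partialDeriv i (θ t)) x +
        (FunctionSpaces.Torus.partialDeriv i (s t) x -
          ⟪FunctionSpaces.Torus.partialDeriv i (u t) x, FunctionSpaces.Torus.gradient (θ t) x⟫_ℝ) := by
  have hU : UniqueDiffOn ℝ (Icc a b) := uniqueDiffOn_Icc hab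
  have hθs := h.smooth_scalar
  have hθt : FunctionSpaces.Torus.IsSmooth (θ t) := hθs.isSmooth_slice ht
  have hut : FunctionSpaces.Torus.IsSmooth (u t) := h.smooth_velocity.isSmooth_slice ht
  have hst : FunctionSpaces.Torus.IsSmooth (s t) := h.smooth_source.isSmooth_slice ht
  have hA : FunctionSpaces.Torus.IsSmooth (FunctionSpaces.Torus.timeDerivWithin (Icc a b) θ t) :=
    hθs.isSmooth_timeDerivWithin hU ht
  -- the equation at time `t` as an identity of functions of `x`
  have heq : (FunctionSpaces.Torus.timeDerivWithin (Icc a b) θ t +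
      fun y => ⟪u t y, FunctionSpaces.Torus.gradient (θ t) y⟫_ℝ) =
      κ • FunctionSpaces.Torus.laplacian (θ t) + s t := by
    funext y
    simpa [Pi.add_apply, Pi.smul_apply, smul_eq_mul] using h.transport t ht y
  have hcongr : FunctionSpaces.Torus.partialDeriv i (FunctionSpaces.Torus.timeDerivWithin (Icc a b) θ t +
      fun y => ⟪u t y, FunctionSpaces.Torus.gradient (θ t) y⟫_ℝ) x =
      FunctionSpaces.Torus.partialDeriv i (κ • FunctionSpaces.Torus.laplacian (θ t) + s t) x := by rw [heq]
  rw [FunctionSpaces.Torus.partialDeriv_add (hA.isContDiff (by simp))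
      ((hut.inner hθt.gradient).isContDiff (by simp)), Pi.add_apply,
    FunctionSpaces.Torus.partialDeriv_inner (hut.isContDiff (by simp)) (hθt.gradient.isContDiff (by simp)),
    FunctionSpaces.Torus.partialDeriv_gradient_comm hθt,
    FunctionSpaces.Torus.partialDeriv_add ((hθt.laplacian.isContDiff (by simp)).smul κ)
      (hst.isContDiff (by simp)), Pi.add_apply,
    FunctionSpaces.Torus.partialDeriv_const_smul (hθt.laplacian.isContDiff (by simp)), Pi.smul_apply,
    FunctionSpaces.Torus.partialDeriv_laplacian_comm hθt, smul_eq_mul,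
    ← FunctionSpaces.Torus.timeDerivWithin_partialDeriv_comm hab hθs ht i x] at hcongr
  linarith

/-- **`∂ᵢθ` is a classical forced solution**, with the same drift and diffusivity and the source
`∂ᵢs − ⟪∂ᵢu, ∇θ⟫` (Evans 2010 §7.1.3, proof of Thm. 5; tree twin for `s = 0` and shear drifts:
`IsClassicalScalarTransportOn.partialDeriv_of_partialDeriv_velocity_eq_zero`).
[cite: Evans2010, §7.1.3 Thm. 5 (proof: differentiate the equation with respect to x_k)] -/
theorem partialDeriv {a b : ℝ} (hab : a < b) (h : IsClassicalScalarTransportForcedOn (Icc a b) κ u s θ)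
    (i : d) :
    IsClassicalScalarTransportForcedOn (Icc a b) κ u
      (fun τ x => FunctionSpaces.Torus.partialDeriv i (s τ) x -
        ⟪FunctionSpaces.Torus.partialDeriv i (u τ) x, FunctionSpaces.Torus.gradient (θ τ) x⟫_ℝ)
      (fun τ => FunctionSpaces.Torus.partialDeriv i (θ τ)) where
  smooth_velocity := h.smooth_velocity
  smooth_source :=
    (h.smooth_source.partialDeriv (uniqueDiffOn_Icc hab) i).sub
      ((h.smooth_velocity.partialDeriv (uniqueDiffOn_Icc hab) i).inner
        (h.smooth_scalar.gradient (uniqueDiffOn_Icc hab)))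
  smooth_scalar := h.smooth_scalar.partialDeriv (uniqueDiffOn_Icc hab) i
  transport _ ht x := h.partialDeriv_transport hab i ht x
  divFree := h.divFree

/-! ### The `L²` level -/

/-- **`L²` balance of the forced equation**: within a convex time set,
`d/dt ∫ θ² = −2κ ∫ ‖∇θ‖² + 2 ∫ θ s` (the renormalised balance with `β(r) = r²`).
[cite: DiPernaLions1989Invent, §II.3] -/
theorem hasDerivWithinAt_integral_sq {S : Set ℝ} (h : IsClassicalScalarTransportForcedOn S κ u s θ)
    (hS : Convex ℝ S) {t : ℝ} (ht : t ∈ S) :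
    HasDerivWithinAt (fun τ => ∫ x, θ τ x ^ 2)
      (-(2 * κ * ∫ x, ‖FunctionSpaces.Torus.gradient (θ t) x‖ ^ 2) + 2 * ∫ x, θ t x * s t x) S t := by
  have e1 : deriv (fun r : ℝ => r ^ 2) = fun r => 2 * r := by funext r; simp
  have e2 : deriv (fun r : ℝ => 2 * r) = fun _ => (2 : ℝ) := by
    funext r; rw [deriv_const_mul 2 differentiableAt_id, deriv_id'', mul_one]
  have h1 := h.hasDerivWithinAt_integral_comp hS (β := fun r : ℝ => r ^ 2) (contDiff_id.pow 2) ht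
  rw [e1, e2] at h1
  dsimp only at h1
  have ia : ∫ x, (2 : ℝ) * ‖FunctionSpaces.Torus.gradient (θ t) x‖ ^ 2 =
      2 * ∫ x, ‖FunctionSpaces.Torus.gradient (θ t) x‖ ^ 2 := integral_const_mul _ _
  have ib : ∫ x, 2 * θ t x * s t x = 2 * ∫ x, θ t x * s t x := by
    rw [← integral_const_mul]
    refine integral_congr_ae (ae_of_all _ fun x => ?_)
    ring
  convert h1 using 1
  rw [ia, ib]
  ring

/-- The right-hand side of the `L²` balance is continuous in time on a convex time set (joint
smoothness of the integrands). [cite: DiPernaLions1989Invent, §II.3] -/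
theorem continuousOn_integral_sq_deriv {S : Set ℝ} (h : IsClassicalScalarTransportForcedOn S κ u s θ)
    (hS : Convex ℝ S) (hU : UniqueDiffOn ℝ S) :
    ContinuousOn (fun τ => -(2 * κ * ∫ x, ‖FunctionSpaces.Torus.gradient (θ τ) x‖ ^ 2) +
      2 * ∫ x, θ τ x * s τ x) S := by
  have hθ := h.smooth_scalar
  have hg2 : FunctionSpaces.Torus.IsSmoothSpaceTimeOn S
      (fun τ x => ‖FunctionSpaces.Torus.gradient (θ τ) x‖ ^ 2) := by
    change ContDiffOn ℝ ∞ (fun z => ‖FunctionSpaces.Torus.stLift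
      (fun τ => FunctionSpaces.Torus.gradient (θ τ)) z‖ ^ 2) (S ×ˢ Set.univ)
    exact (hθ.gradient hU).norm_sq ℝ
  have c1 : ContinuousOn (fun τ => ∫ x, ‖FunctionSpaces.Torus.gradient (θ τ) x‖ ^ 2) S :=
    hg2.continuousOn_integral hS
  have c2 : ContinuousOn (fun τ => ∫ x, θ τ x * s τ x) S :=
    (hθ.mul h.smooth_source).continuousOn_integral hS
  exact (continuousOn_const.mul c1).neg.add (continuousOn_const.mul c2)

/-- **`L²` growth by the source, uniformly in `κ ≥ 0`.** For a classical forced solution on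
`S ⊇ [a, b]` with `‖s(τ)‖_{L²} ≤ G(τ)` (`G ≥ 0` continuous on `[a, b]`):
`‖θ(t)‖_{L²} ≤ ‖θ(a)‖_{L²} + ∫ₐᵗ G` for `t ∈ [a, b]` (`d/dt‖θ‖² ≤ 2‖θ‖‖s‖`, comparison lemma).
[cite: DiPernaLions1989Invent, §II.3] -/
theorem sqrt_integral_sq_le {S : Set ℝ} (h : IsClassicalScalarTransportForcedOn S κ u s θ) (hκ : 0 ≤ κ)
    {a b : ℝ} (hI : Icc a b ⊆ S) {G : ℝ → ℝ} (hGc : ContinuousOn G (Icc a b))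
    (hG0 : ∀ τ ∈ Icc a b, 0 ≤ G τ)
    (hsG : ∀ τ ∈ Icc a b, Real.sqrt (∫ x, s τ x ^ 2) ≤ G τ) {t : ℝ} (ht : t ∈ Icc a b) :
    Real.sqrt (∫ x, θ t x ^ 2) ≤ Real.sqrt (∫ x, θ a x ^ 2) + ∫ τ in a..t, G τ := by
  rcases eq_or_lt_of_le ht.1 with rfl | hat
  · simp
  have hab : a < b := hat.trans_le ht.2
  have hsub : Icc a t ⊆ Icc a b := Icc_subset_Icc_right ht.2
  have h' := h.restrict_Icc hat (hsub.trans hI)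
  have hEd := fun τ (hτ : τ ∈ Icc a t) => h'.hasDerivWithinAt_integral_sq (convex_Icc a t) hτ
  have hDc := h'.continuousOn_integral_sq_deriv (convex_Icc a t) (uniqueDiffOn_Icc hat)
  have hEpos : ∀ τ ∈ Icc a t, 0 ≤ ∫ x, θ τ x ^ 2 := fun τ _ => integral_nonneg fun x => sq_nonneg _
  have hle : ∀ τ ∈ Icc a t, -(2 * κ * ∫ x, ‖FunctionSpaces.Torus.gradient (θ τ) x‖ ^ 2) +
      2 * ∫ x, θ τ x * s τ x ≤ 2 * Real.sqrt (∫ x, θ τ x ^ 2) * G τ := by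
    intro τ hτ
    have hθτ : FunctionSpaces.Torus.IsSmooth (θ τ) := h'.smooth_scalar.isSmooth_slice hτ
    have hsτ : FunctionSpaces.Torus.IsSmooth (s τ) := h'.smooth_source.isSmooth_slice hτ
    have i1 : -(2 * κ * ∫ x, ‖FunctionSpaces.Torus.gradient (θ τ) x‖ ^ 2) ≤ 0 := by
      have : 0 ≤ ∫ x, ‖FunctionSpaces.Torus.gradient (θ τ) x‖ ^ 2 := integral_nonneg fun x => sq_nonneg _
      nlinarith
    have hcs := Torus.integral_mul_le_sqrt_mul_sqrt hθτ.continuous hsτ.continuous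
    have hs2 := hsG τ (hsub hτ)
    have hE0 : 0 ≤ Real.sqrt (∫ x, θ τ x ^ 2) := Real.sqrt_nonneg _
    have i2 : 2 * ∫ x, θ τ x * s τ x ≤ 2 * Real.sqrt (∫ x, θ τ x ^ 2) * G τ := by
      calc 2 * ∫ x, θ τ x * s τ x
          ≤ 2 * (Real.sqrt (∫ x, θ τ x ^ 2) * Real.sqrt (∫ x, s τ x ^ 2)) := by linarith
        _ ≤ 2 * (Real.sqrt (∫ x, θ τ x ^ 2) * G τ) := by gcongr
        _ = 2 * Real.sqrt (∫ x, θ τ x ^ 2) * G τ := by ring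
    linarith
  exact ForcedGradientGrowth.sqrt_le_sqrt_add_integral_Icc hat.le hEd hDc hEpos hle
    (fun τ hτ => hG0 τ (hsub hτ)) (hGc.mono hsub)

/-- **`L²` growth with linear feedback (Grönwall form), uniformly in `κ ≥ 0`.** If the source is
controlled by the solution itself, `‖s(τ)‖_{L²} ≤ Λ‖θ(τ)‖_{L²} + G(τ)` on `[a, b]` (`Λ ≥ 0`, `G ≥ 0`
continuous), then `‖θ(t)‖_{L²} ≤ e^{Λ(t−a)} (‖θ(a)‖_{L²} + ∫ₐᵗ G)` for `t ∈ [a, b]`.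
[cite: Evans2010, §7.1.2 Thm. 2 (energy estimates; Gronwall)] -/
theorem sqrt_integral_sq_le_exp {S : Set ℝ} (h : IsClassicalScalarTransportForcedOn S κ u s θ)
    (hκ : 0 ≤ κ) {a b : ℝ} (hI : Icc a b ⊆ S) {Λ : ℝ} (hΛ : 0 ≤ Λ) {G : ℝ → ℝ}
    (hGc : ContinuousOn G (Icc a b)) (hG0 : ∀ τ ∈ Icc a b, 0 ≤ G τ)
    (hsG : ∀ τ ∈ Icc a b, Real.sqrt (∫ x, s τ x ^ 2) ≤ Λ * Real.sqrt (∫ x, θ τ x ^ 2) + G τ)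
    {t : ℝ} (ht : t ∈ Icc a b) :
    Real.sqrt (∫ x, θ t x ^ 2) ≤
      Real.exp (Λ * (t - a)) * (Real.sqrt (∫ x, θ a x ^ 2) + ∫ τ in a..t, G τ) := by
  rcases eq_or_lt_of_le ht.1 with rfl | hat
  · simp
  have hab : a < b := hat.trans_le ht.2
  have hsub : Icc a t ⊆ Icc a b := Icc_subset_Icc_right ht.2
  have h' := h.restrict_Icc hat (hsub.trans hI)
  have hEd := fun τ (hτ : τ ∈ Icc a t) => h'.hasDerivWithinAt_integral_sq (convex_Icc a t) hτ
  have hDc := h'.continuousOn_integral_sq_deriv (convex_Icc a t) (uniqueDiffOn_Icc hat)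
  have hEpos : ∀ τ ∈ Icc a t, 0 ≤ ∫ x, θ τ x ^ 2 := fun τ _ => integral_nonneg fun x => sq_nonneg _
  have hle : ∀ τ ∈ Icc a t, -(2 * κ * ∫ x, ‖FunctionSpaces.Torus.gradient (θ τ) x‖ ^ 2) +
      2 * ∫ x, θ τ x * s τ x ≤
        2 * Real.sqrt (∫ x, θ τ x ^ 2) * (Λ * Real.sqrt (∫ x, θ τ x ^ 2) + G τ) := by
    intro τ hτ
    have hθτ : FunctionSpaces.Torus.IsSmooth (θ τ) := h'.smooth_scalar.isSmooth_slice hτ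
    have hsτ : FunctionSpaces.Torus.IsSmooth (s τ) := h'.smooth_source.isSmooth_slice hτ
    have i1 : -(2 * κ * ∫ x, ‖FunctionSpaces.Torus.gradient (θ τ) x‖ ^ 2) ≤ 0 := by
      have : 0 ≤ ∫ x, ‖FunctionSpaces.Torus.gradient (θ τ) x‖ ^ 2 := integral_nonneg fun x => sq_nonneg _
      nlinarith
    have hcs := Torus.integral_mul_le_sqrt_mul_sqrt hθτ.continuous hsτ.continuous
    have hs2 := hsG τ (hsub hτ)
    have hE0 : 0 ≤ Real.sqrt (∫ x, θ τ x ^ 2) := Real.sqrt_nonneg _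
    have i2 : 2 * ∫ x, θ τ x * s τ x ≤
        2 * Real.sqrt (∫ x, θ τ x ^ 2) * (Λ * Real.sqrt (∫ x, θ τ x ^ 2) + G τ) := by
      calc 2 * ∫ x, θ τ x * s τ x
          ≤ 2 * (Real.sqrt (∫ x, θ τ x ^ 2) * Real.sqrt (∫ x, s τ x ^ 2)) := by linarith
        _ ≤ 2 * (Real.sqrt (∫ x, θ τ x ^ 2) * (Λ * Real.sqrt (∫ x, θ τ x ^ 2) + G τ)) := by gcongr
        _ = 2 * Real.sqrt (∫ x, θ τ x ^ 2) * (Λ * Real.sqrt (∫ x, θ τ x ^ 2) + G τ) := by ring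
    linarith
  exact ForcedGradientGrowth.sqrt_le_exp_mul_Icc hat.le hΛ hEd hDc hEpos hle
    (fun τ hτ => hG0 τ (hsub hτ)) (hGc.mono hsub)

/-! ### The `H¹` level -/

omit [DecidableEq d] in
/-- Continuous real functions on the torus are integrable. [folklore] -/
private theorem integrable_of_continuous' {f : UnitAddTorus d → ℝ} (hf : Continuous f) :
    Integrable f volume :=
  hf.integrable_unitAddTorus

/-- `‖∇φ‖²_{L²} = ∑ₖ ‖∂ₖφ‖²_{L²}` for smooth scalars. [folklore] -/
private theorem scalarGradNormSq_eq_sum {φ : UnitAddTorus d → ℝ} (hφ : FunctionSpaces.Torus.IsSmooth φ) :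
    scalarGradNormSq φ = ∑ k, ∫ x, (FunctionSpaces.Torus.partialDeriv k φ x) ^ 2 := by
  unfold scalarGradNormSq
  simp_rw [norm_gradient_sq_eq_sum (hφ.isContDiff (by simp))]
  exact integral_finsetSum _ fun k _ =>
    integrable_of_continuous' (((hφ.partialDeriv k).continuous).pow 2)

/-- `‖∂ₖφ‖²_{L²} ≤ ‖∇φ‖²_{L²}`. [folklore] -/
private theorem integral_partialDeriv_sq_le {φ : UnitAddTorus d → ℝ} (hφ : FunctionSpaces.Torus.IsSmooth φ)
    (k : d) : ∫ x, (FunctionSpaces.Torus.partialDeriv k φ x) ^ 2 ≤ scalarGradNormSq φ := by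
  rw [scalarGradNormSq_eq_sum hφ]
  exact Finset.single_le_sum (f := fun j => ∫ x, (FunctionSpaces.Torus.partialDeriv j φ x) ^ 2)
    (fun j _ => integral_nonneg fun x => sq_nonneg _) (Finset.mem_univ k)

/-- The production term of the `∂ₖ`-equation, bounded: for smooth `φ`, `ψ` and a field `v` with
`‖∂ₖv‖ ≤ Λ` pointwise (`Λ ≥ 0`),
`2 ∫ ∂ₖφ (∂ₖψ − ⟪∂ₖv, ∇φ⟫) ≤ 2 ‖∂ₖφ‖₂‖∂ₖψ‖₂ + 2Λ ‖∂ₖφ‖₂ ‖∇φ‖₂`. [folklore] -/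
private theorem two_mul_integral_partialDeriv_mul_source_le {φ ψ : UnitAddTorus d → ℝ}
    {v : UnitAddTorus d → EuclideanSpace ℝ d} (hφ : FunctionSpaces.Torus.IsSmooth φ)
    (hψ : FunctionSpaces.Torus.IsSmooth ψ) (hv : FunctionSpaces.Torus.IsSmooth v) {Λ : ℝ} (k : d)
    (hL : ∀ x, ‖FunctionSpaces.Torus.partialDeriv k v x‖ ≤ Λ) :
    2 * ∫ x, FunctionSpaces.Torus.partialDeriv k φ x * (FunctionSpaces.Torus.partialDeriv k ψ x -
        ⟪FunctionSpaces.Torus.partialDeriv k v x, FunctionSpaces.Torus.gradient φ x⟫_ℝ) ≤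
      2 * (Real.sqrt (∫ x, (FunctionSpaces.Torus.partialDeriv k φ x) ^ 2) *
          Real.sqrt (∫ x, (FunctionSpaces.Torus.partialDeriv k ψ x) ^ 2)) +
        2 * Λ * (Real.sqrt (∫ x, (FunctionSpaces.Torus.partialDeriv k φ x) ^ 2) *
          Real.sqrt (scalarGradNormSq φ)) := by
  have cφk : Continuous (FunctionSpaces.Torus.partialDeriv k φ) := (hφ.partialDeriv k).continuous
  have cψk : Continuous (FunctionSpaces.Torus.partialDeriv k ψ) := (hψ.partialDeriv k).continuous
  have cvk : Continuous (FunctionSpaces.Torus.partialDeriv k v) := (hv.partialDeriv k).continuous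
  have cg : Continuous (FunctionSpaces.Torus.gradient φ) := hφ.gradient.continuous
  have cin : Continuous fun x => ⟪FunctionSpaces.Torus.partialDeriv k v x, FunctionSpaces.Torus.gradient φ x⟫_ℝ :=
    cvk.inner cg
  have i1 : Integrable (fun x => FunctionSpaces.Torus.partialDeriv k φ x * FunctionSpaces.Torus.partialDeriv k ψ x)
      volume := integrable_of_continuous' (cφk.mul cψk)
  have i2 : Integrable (fun x => FunctionSpaces.Torus.partialDeriv k φ x *
      ⟪FunctionSpaces.Torus.partialDeriv k v x, FunctionSpaces.Torus.gradient φ x⟫_ℝ) volume :=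
    integrable_of_continuous' (cφk.mul cin)
  have hsplit : ∫ x, FunctionSpaces.Torus.partialDeriv k φ x * (FunctionSpaces.Torus.partialDeriv k ψ x -
      ⟪FunctionSpaces.Torus.partialDeriv k v x, FunctionSpaces.Torus.gradient φ x⟫_ℝ) =
      (∫ x, FunctionSpaces.Torus.partialDeriv k φ x * FunctionSpaces.Torus.partialDeriv k ψ x) -
        ∫ x, FunctionSpaces.Torus.partialDeriv k φ x *
          ⟪FunctionSpaces.Torus.partialDeriv k v x, FunctionSpaces.Torus.gradient φ x⟫_ℝ := by
    rw [← integral_sub i1 i2]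
    refine integral_congr_ae (ae_of_all _ fun x => ?_)
    ring
  -- (i) Cauchy–Schwarz for the source pairing
  have hcs1 := Torus.integral_mul_le_sqrt_mul_sqrt cφk cψk
  -- (ii) the production: `-∫ ∂ₖφ ⟪∂ₖv, ∇φ⟫ ≤ Λ ∫ |∂ₖφ| ‖∇φ‖ ≤ Λ ‖∂ₖφ‖₂ ‖∇φ‖₂`
  have cabs : Continuous fun x => |FunctionSpaces.Torus.partialDeriv k φ x| := cφk.abs
  have cng : Continuous fun x => ‖FunctionSpaces.Torus.gradient φ x‖ := cg.norm
  have hpt : ∀ x, -(FunctionSpaces.Torus.partialDeriv k φ x *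
      ⟪FunctionSpaces.Torus.partialDeriv k v x, FunctionSpaces.Torus.gradient φ x⟫_ℝ) ≤
      Λ * (|FunctionSpaces.Torus.partialDeriv k φ x| * ‖FunctionSpaces.Torus.gradient φ x‖) := by
    intro x
    have h1 : |FunctionSpaces.Torus.partialDeriv k φ x *
        ⟪FunctionSpaces.Torus.partialDeriv k v x, FunctionSpaces.Torus.gradient φ x⟫_ℝ| ≤
        |FunctionSpaces.Torus.partialDeriv k φ x| * (Λ * ‖FunctionSpaces.Torus.gradient φ x‖) := by
      rw [abs_mul]
      refine mul_le_mul_of_nonneg_left ?_ (abs_nonneg _)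
      calc |⟪FunctionSpaces.Torus.partialDeriv k v x, FunctionSpaces.Torus.gradient φ x⟫_ℝ|
          ≤ ‖FunctionSpaces.Torus.partialDeriv k v x‖ * ‖FunctionSpaces.Torus.gradient φ x‖ :=
            abs_real_inner_le_norm _ _
        _ ≤ Λ * ‖FunctionSpaces.Torus.gradient φ x‖ :=
            mul_le_mul_of_nonneg_right (hL x) (norm_nonneg _)
    have h2 := neg_abs_le (FunctionSpaces.Torus.partialDeriv k φ x *
        ⟪FunctionSpaces.Torus.partialDeriv k v x, FunctionSpaces.Torus.gradient φ x⟫_ℝ)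
    nlinarith [h1, h2]
  have hprod : -(∫ x, FunctionSpaces.Torus.partialDeriv k φ x *
      ⟪FunctionSpaces.Torus.partialDeriv k v x, FunctionSpaces.Torus.gradient φ x⟫_ℝ) ≤
      Λ * (Real.sqrt (∫ x, (FunctionSpaces.Torus.partialDeriv k φ x) ^ 2) *
        Real.sqrt (scalarGradNormSq φ)) := by
    rw [← integral_neg]
    have i3 : Integrable (fun x => Λ * (|FunctionSpaces.Torus.partialDeriv k φ x| *
        ‖FunctionSpaces.Torus.gradient φ x‖)) volume :=
      integrable_of_continuous' (continuous_const.mul (cabs.mul cng))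
    have step1 : ∫ x, -(FunctionSpaces.Torus.partialDeriv k φ x *
        ⟪FunctionSpaces.Torus.partialDeriv k v x, FunctionSpaces.Torus.gradient φ x⟫_ℝ) ≤
        ∫ x, Λ * (|FunctionSpaces.Torus.partialDeriv k φ x| * ‖FunctionSpaces.Torus.gradient φ x‖) :=
      integral_mono i2.neg i3 hpt
    have hcs2 := Torus.integral_mul_le_sqrt_mul_sqrt cabs cng
    have e1 : ∫ x, |FunctionSpaces.Torus.partialDeriv k φ x| ^ 2 =
        ∫ x, (FunctionSpaces.Torus.partialDeriv k φ x) ^ 2 :=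
      integral_congr_ae (ae_of_all _ fun x => sq_abs _)
    have e2 : ∫ x, ‖FunctionSpaces.Torus.gradient φ x‖ ^ 2 = scalarGradNormSq φ := rfl
    rw [e1, e2] at hcs2
    rw [integral_const_mul] at step1
    have hΛ0 : 0 ≤ Λ := (norm_nonneg _).trans (hL (0 : UnitAddTorus d))
    exact step1.trans (mul_le_mul_of_nonneg_left hcs2 hΛ0)
  rw [hsplit]
  linarith

/-- **Gradient growth for the forced transport–diffusion equation, uniformly in `κ ≥ 0`.** Let `θ`
solve `∂ₜθ + u·∇θ = κΔθ + s`, `div u = 0`, classically on `S ⊇ [a, b]`, with `‖∂ₖu(τ, x)‖ ≤ Λ` for all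
`τ ∈ [a, b]`, `x`, `k` (`Λ ≥ 0`) and `‖∇s(τ)‖_{L²} ≤ G(τ)` (`G ≥ 0` continuous). Then for `t ∈ [a, b]`
`‖∇θ(t)‖_{L²} ≤ e^{dΛ(t−a)} (‖∇θ(a)‖_{L²} + ∫ₐᵗ G)`, `d = card d`:
each `∂ₖθ` solves the equation with source `∂ₖs − ⟪∂ₖu, ∇θ⟫` (`partialDeriv`), so
`d/dt ‖∇θ‖₂² = −2κ‖∇²θ‖₂² + 2∑ₖ∫∂ₖθ(∂ₖs − ⟪∂ₖu, ∇θ⟫) ≤ 2‖∇θ‖₂(‖∇s‖₂ + dΛ‖∇θ‖₂)`, and the weighted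
comparison lemma closes. The prescribed-drift case of the `H^m` energy estimate, `m = 1`, with the
constant displayed; no `κ⁻¹`. [cite: MajdaBertozzi2002, §3.2 Prop. 3.7 (3.58)–(3.60) (the H^m energy estimate, uniform in the viscosity; here m = 1, prescribed drift)] -/
theorem sqrt_scalarGradNormSq_le_exp {S : Set ℝ} (h : IsClassicalScalarTransportForcedOn S κ u s θ)
    (hκ : 0 ≤ κ) {a b : ℝ} (hI : Icc a b ⊆ S) {Λ : ℝ} (hΛ : 0 ≤ Λ)
    (hL : ∀ τ ∈ Icc a b, ∀ x, ∀ k, ‖FunctionSpaces.Torus.partialDeriv k (u τ) x‖ ≤ Λ)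
    {G : ℝ → ℝ} (hGc : ContinuousOn G (Icc a b)) (hG0 : ∀ τ ∈ Icc a b, 0 ≤ G τ)
    (hsG : ∀ τ ∈ Icc a b, Real.sqrt (scalarGradNormSq (s τ)) ≤ G τ) {t : ℝ} (ht : t ∈ Icc a b) :
    Real.sqrt (scalarGradNormSq (θ t)) ≤
      Real.exp (Fintype.card d * Λ * (t - a)) *
        (Real.sqrt (scalarGradNormSq (θ a)) + ∫ τ in a..t, G τ) := by
  rcases eq_or_lt_of_le ht.1 with rfl | hat
  · simp
  have hsub : Icc a t ⊆ Icc a b := Icc_subset_Icc_right ht.2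
  have h' := h.restrict_Icc hat (hsub.trans hI)
  have hk := fun k => h'.partialDeriv hat k
  set E : ℝ → ℝ := fun τ => ∑ k, ∫ x, (FunctionSpaces.Torus.partialDeriv k (θ τ) x) ^ 2 with hE
  set D : ℝ → ℝ := fun τ => ∑ k,
    (-(2 * κ * ∫ x, ‖FunctionSpaces.Torus.gradient (FunctionSpaces.Torus.partialDeriv k (θ τ)) x‖ ^ 2) +
      2 * ∫ x, FunctionSpaces.Torus.partialDeriv k (θ τ) x * (FunctionSpaces.Torus.partialDeriv k (s τ) x -
        ⟪FunctionSpaces.Torus.partialDeriv k (u τ) x, FunctionSpaces.Torus.gradient (θ τ) x⟫_ℝ)) with hD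
  have hEθ : ∀ τ ∈ Icc a t, scalarGradNormSq (θ τ) = E τ := fun τ hτ =>
    scalarGradNormSq_eq_sum (h'.smooth_scalar.isSmooth_slice hτ)
  have hEd : ∀ τ ∈ Icc a t, HasDerivWithinAt E (D τ) (Icc a t) τ := by
    intro τ hτ
    exact HasDerivWithinAt.fun_sum (u := Finset.univ)
      fun k _ => (hk k).hasDerivWithinAt_integral_sq (convex_Icc a t) hτ
  have hDc : ContinuousOn D (Icc a t) :=
    continuousOn_finsetSum _ fun k _ =>
      (hk k).continuousOn_integral_sq_deriv (convex_Icc a t) (uniqueDiffOn_Icc hat)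
  have hEpos : ∀ τ ∈ Icc a t, 0 ≤ E τ := fun τ _ =>
    Finset.sum_nonneg fun k _ => integral_nonneg fun x => sq_nonneg _
  have hle : ∀ τ ∈ Icc a t, D τ ≤
      2 * Real.sqrt (E τ) * (Fintype.card d * Λ * Real.sqrt (E τ) + G τ) := by
    intro τ hτ
    have hθτ : FunctionSpaces.Torus.IsSmooth (θ τ) := h'.smooth_scalar.isSmooth_slice hτ
    have hsτ : FunctionSpaces.Torus.IsSmooth (s τ) := h'.smooth_source.isSmooth_slice hτ
    have huτ : FunctionSpaces.Torus.IsSmooth (u τ) := h'.smooth_velocity.isSmooth_slice hτ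
    set A : d → ℝ := fun k => Real.sqrt (∫ x, (FunctionSpaces.Torus.partialDeriv k (θ τ) x) ^ 2) with hA
    set B : d → ℝ := fun k => Real.sqrt (∫ x, (FunctionSpaces.Torus.partialDeriv k (s τ) x) ^ 2) with hB
    have hA2 : ∑ k, A k ^ 2 = E τ := by
      refine Finset.sum_congr rfl fun k _ => ?_
      exact Real.sq_sqrt (integral_nonneg fun x => sq_nonneg _)
    have hB2 : ∑ k, B k ^ 2 = scalarGradNormSq (s τ) := by
      rw [scalarGradNormSq_eq_sum hsτ]
      refine Finset.sum_congr rfl fun k _ => ?_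
      exact Real.sq_sqrt (integral_nonneg fun x => sq_nonneg _)
    have hAle : ∀ k, A k ≤ Real.sqrt (E τ) := fun k => by
      rw [← hEθ τ hτ]
      exact Real.sqrt_le_sqrt (integral_partialDeriv_sq_le hθτ k)
    have hterm : ∀ k,
        (-(2 * κ * ∫ x, ‖FunctionSpaces.Torus.gradient (FunctionSpaces.Torus.partialDeriv k (θ τ)) x‖ ^ 2) +
          2 * ∫ x, FunctionSpaces.Torus.partialDeriv k (θ τ) x * (FunctionSpaces.Torus.partialDeriv k (s τ) x -
            ⟪FunctionSpaces.Torus.partialDeriv k (u τ) x, FunctionSpaces.Torus.gradient (θ τ) x⟫_ℝ)) ≤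
        2 * (A k * B k) + 2 * Λ * (A k * Real.sqrt (E τ)) := by
      intro k
      have i1 : -(2 * κ * ∫ x, ‖FunctionSpaces.Torus.gradient
          (FunctionSpaces.Torus.partialDeriv k (θ τ)) x‖ ^ 2) ≤ 0 := by
        have : 0 ≤ ∫ x, ‖FunctionSpaces.Torus.gradient (FunctionSpaces.Torus.partialDeriv k (θ τ)) x‖ ^ 2 :=
          integral_nonneg fun x => sq_nonneg _
        nlinarith
      have i2 := two_mul_integral_partialDeriv_mul_source_le hθτ hsτ huτ k (fun x => hL τ (hsub hτ) x k)
      rw [hEθ τ hτ] at i2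
      linarith
    have hsum := Finset.sum_le_sum fun k (_ : k ∈ Finset.univ) => hterm k
    have hAB : ∑ k, A k * B k ≤ Real.sqrt (E τ) * G τ := by
      calc ∑ k, A k * B k ≤ Real.sqrt (∑ k, A k ^ 2) * Real.sqrt (∑ k, B k ^ 2) :=
            Real.sum_mul_le_sqrt_mul_sqrt _ _ _
        _ = Real.sqrt (E τ) * Real.sqrt (scalarGradNormSq (s τ)) := by rw [hA2, hB2]
        _ ≤ Real.sqrt (E τ) * G τ :=
            mul_le_mul_of_nonneg_left (hsG τ (hsub hτ)) (Real.sqrt_nonneg _)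
    have hAsum : ∑ k, A k * Real.sqrt (E τ) ≤ Fintype.card d * (Real.sqrt (E τ) * Real.sqrt (E τ)) := by
      calc ∑ k, A k * Real.sqrt (E τ) ≤ ∑ _k : d, Real.sqrt (E τ) * Real.sqrt (E τ) :=
            Finset.sum_le_sum fun k _ => mul_le_mul_of_nonneg_right (hAle k) (Real.sqrt_nonneg _)
        _ = Fintype.card d * (Real.sqrt (E τ) * Real.sqrt (E τ)) := by
            rw [Finset.sum_const, Finset.card_univ, nsmul_eq_mul]
    have hDτ : D τ = ∑ k,
        ((-(2 * κ * ∫ x, ‖FunctionSpaces.Torus.gradient (FunctionSpaces.Torus.partialDeriv k (θ τ)) x‖ ^ 2)) +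
          2 * ∫ x, FunctionSpaces.Torus.partialDeriv k (θ τ) x * (FunctionSpaces.Torus.partialDeriv k (s τ) x -
            ⟪FunctionSpaces.Torus.partialDeriv k (u τ) x, FunctionSpaces.Torus.gradient (θ τ) x⟫_ℝ)) := rfl
    have hrhs : ∑ k, (2 * (A k * B k) + 2 * Λ * (A k * Real.sqrt (E τ))) =
        2 * ∑ k, A k * B k + 2 * Λ * ∑ k, A k * Real.sqrt (E τ) := by
      rw [Finset.sum_add_distrib, ← Finset.mul_sum, ← Finset.mul_sum]
    rw [hrhs] at hsum
    rw [hDτ]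
    have hG := hG0 τ (hsub hτ)
    have hsq : Real.sqrt (E τ) * Real.sqrt (E τ) = E τ := Real.mul_self_sqrt (hEpos τ hτ)
    nlinarith [hsum, hAB, hAsum, Real.sqrt_nonneg (E τ), mul_nonneg hΛ (Real.sqrt_nonneg (E τ))]
  have hΛ' : 0 ≤ (Fintype.card d : ℝ) * Λ := mul_nonneg (Nat.cast_nonneg _) hΛ
  have key := ForcedGradientGrowth.sqrt_le_exp_mul_Icc (Λ := Fintype.card d * Λ) hat.le hΛ' hEd hDc hEpos
    hle (fun τ hτ => hG0 τ (hsub hτ)) (hGc.mono hsub)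
  rw [hEθ t (right_mem_Icc.mpr hat.le), hEθ a (left_mem_Icc.mpr hat.le)]
  exact key

/-! ### The `H²` level -/

omit [DecidableEq d] in
/-- `‖⟪V, W⟫‖_{L²} ≤ Λ ‖W‖_{L²}` when `‖V‖ ≤ Λ` pointwise (continuous `V`, `W`). [folklore] -/
private theorem sqrt_integral_inner_sq_le {V W : UnitAddTorus d → EuclideanSpace ℝ d}
    (hV : Continuous V) (hW : Continuous W) {Λ : ℝ} (hΛ : 0 ≤ Λ) (hL : ∀ x, ‖V x‖ ≤ Λ) :
    Real.sqrt (∫ x, ⟪V x, W x⟫_ℝ ^ 2) ≤ Λ * Real.sqrt (∫ x, ‖W x‖ ^ 2) := by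
  have i1 : Integrable (fun x => ⟪V x, W x⟫_ℝ ^ 2) volume := ((hV.inner hW).pow 2).integrable_unitAddTorus
  have i2 : Integrable (fun x => Λ ^ 2 * ‖W x‖ ^ 2) volume :=
    (continuous_const.mul (hW.norm.pow 2)).integrable_unitAddTorus
  have hle : ∫ x, ⟪V x, W x⟫_ℝ ^ 2 ≤ ∫ x, Λ ^ 2 * ‖W x‖ ^ 2 := by
    refine integral_mono i1 i2 fun x => ?_
    have h1 : |⟪V x, W x⟫_ℝ| ≤ Λ * ‖W x‖ :=
      (abs_real_inner_le_norm _ _).trans (mul_le_mul_of_nonneg_right (hL x) (norm_nonneg _))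
    have h2 : 0 ≤ Λ * ‖W x‖ := mul_nonneg hΛ (norm_nonneg _)
    calc ⟪V x, W x⟫_ℝ ^ 2 = |⟪V x, W x⟫_ℝ| ^ 2 := (sq_abs _).symm
      _ ≤ (Λ * ‖W x‖) ^ 2 := pow_le_pow_left₀ (abs_nonneg _) h1 2
      _ = Λ ^ 2 * ‖W x‖ ^ 2 := by ring
  calc Real.sqrt (∫ x, ⟪V x, W x⟫_ℝ ^ 2) ≤ Real.sqrt (∫ x, Λ ^ 2 * ‖W x‖ ^ 2) := Real.sqrt_le_sqrt hle
    _ = Λ * Real.sqrt (∫ x, ‖W x‖ ^ 2) := by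
        rw [integral_const_mul, Real.sqrt_mul (sq_nonneg _), Real.sqrt_sq hΛ]

omit [DecidableEq d] in
/-- Triangle inequality `‖f − g‖_{L²} ≤ ‖f‖_{L²} + ‖g‖_{L²}` (continuous `f`, `g`). [folklore] -/
private theorem sqrt_integral_sub_sq_le {f g : UnitAddTorus d → ℝ} (hf : Continuous f) (hg : Continuous g) :
    Real.sqrt (∫ x, (f x - g x) ^ 2) ≤ Real.sqrt (∫ x, f x ^ 2) + Real.sqrt (∫ x, g x ^ 2) := by
  have hg' : Continuous fun x => -g x := hg.neg
  have h := Torus.sqrt_integral_add_sq_le hf hg'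
  have e1 : (fun x => (f x + -g x) ^ 2) = fun x => (f x - g x) ^ 2 := by
    funext x; ring
  have e2 : (fun x => (-g x) ^ 2) = fun x => g x ^ 2 := by
    funext x; ring
  simp only [e1, e2] at h
  exact h

/-- `‖∇∂ᵢφ‖²_{L²} ≤ ∑ₘ ∑ₖ ‖∂ₘ∂ₖφ‖²_{L²}`. [folklore] -/
private theorem scalarGradNormSq_partialDeriv_le_sum {φ : UnitAddTorus d → ℝ}
    (hφ : FunctionSpaces.Torus.IsSmooth φ) (i : d) :
    scalarGradNormSq (FunctionSpaces.Torus.partialDeriv i φ) ≤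
      ∑ m, ∑ k, ∫ x, (FunctionSpaces.Torus.partialDeriv m (FunctionSpaces.Torus.partialDeriv k φ) x) ^ 2 := by
  rw [scalarGradNormSq_eq_sum (hφ.partialDeriv i)]
  refine Finset.sum_le_sum fun m _ => ?_
  exact Finset.single_le_sum
    (f := fun k => ∫ x, (FunctionSpaces.Torus.partialDeriv m (FunctionSpaces.Torus.partialDeriv k φ) x) ^ 2)
    (fun k _ => integral_nonneg fun x => sq_nonneg _) (Finset.mem_univ i)

/-- `‖∂ᵢ∂ₖφ‖²_{L²} ≤ ∑ₘ ∑ⱼ ‖∂ₘ∂ⱼφ‖²_{L²}`. [folklore] -/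
private theorem integral_partialDeriv_partialDeriv_sq_le_sum (φ : UnitAddTorus d → ℝ) (i k : d) :
    ∫ x, (FunctionSpaces.Torus.partialDeriv i (FunctionSpaces.Torus.partialDeriv k φ) x) ^ 2 ≤
      ∑ m, ∑ j, ∫ x, (FunctionSpaces.Torus.partialDeriv m (FunctionSpaces.Torus.partialDeriv j φ) x) ^ 2 := by
  have h1 : ∫ x, (FunctionSpaces.Torus.partialDeriv i (FunctionSpaces.Torus.partialDeriv k φ) x) ^ 2 ≤
      ∑ j, ∫ x, (FunctionSpaces.Torus.partialDeriv i (FunctionSpaces.Torus.partialDeriv j φ) x) ^ 2 :=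
    Finset.single_le_sum
      (f := fun j => ∫ x, (FunctionSpaces.Torus.partialDeriv i (FunctionSpaces.Torus.partialDeriv j φ) x) ^ 2)
      (fun j _ => integral_nonneg fun x => sq_nonneg _) (Finset.mem_univ k)
  exact h1.trans (Finset.single_le_sum
    (f := fun m => ∑ j, ∫ x, (FunctionSpaces.Torus.partialDeriv m (FunctionSpaces.Torus.partialDeriv j φ) x) ^ 2)
    (fun m _ => Finset.sum_nonneg fun j _ => integral_nonneg fun x => sq_nonneg _) (Finset.mem_univ i))

omit [DecidableEq d] in
/-- Cauchy–Schwarz for a double finite sum. [folklore] -/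
private theorem sum_sum_mul_le_sqrt_mul_sqrt (A B : d → d → ℝ) :
    ∑ i, ∑ k, A i k * B i k ≤ Real.sqrt (∑ i, ∑ k, A i k ^ 2) * Real.sqrt (∑ i, ∑ k, B i k ^ 2) := by
  rw [← Fintype.sum_prod_type', ← Fintype.sum_prod_type', ← Fintype.sum_prod_type']
  exact Real.sum_mul_le_sqrt_mul_sqrt _ _ _

/-- The second-order source, expanded pointwise: for smooth `φ`, `ψ`, `v`,
`∂ᵢ(∂ₖψ − ⟪∂ₖv, ∇φ⟫) = ∂ᵢ∂ₖψ − ⟪∂ₖv, ∇∂ᵢφ⟫ − ⟪∂ᵢ∂ₖv, ∇φ⟫`. [folklore] -/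
private theorem partialDeriv_source_expand {φ ψ : UnitAddTorus d → ℝ} {v : UnitAddTorus d → EuclideanSpace ℝ d}
    (hφ : FunctionSpaces.Torus.IsSmooth φ) (hψ : FunctionSpaces.Torus.IsSmooth ψ)
    (hv : FunctionSpaces.Torus.IsSmooth v) (i k : d) (x : UnitAddTorus d) :
    FunctionSpaces.Torus.partialDeriv i (fun y => FunctionSpaces.Torus.partialDeriv k ψ y -
        ⟪FunctionSpaces.Torus.partialDeriv k v y, FunctionSpaces.Torus.gradient φ y⟫_ℝ) x =
      FunctionSpaces.Torus.partialDeriv i (FunctionSpaces.Torus.partialDeriv k ψ) x -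
        (⟪FunctionSpaces.Torus.partialDeriv k v x,
            FunctionSpaces.Torus.gradient (FunctionSpaces.Torus.partialDeriv i φ) x⟫_ℝ +
          ⟪FunctionSpaces.Torus.partialDeriv i (FunctionSpaces.Torus.partialDeriv k v) x,
            FunctionSpaces.Torus.gradient φ x⟫_ℝ) := by
  have hf : FunctionSpaces.Torus.IsContDiff 1 (FunctionSpaces.Torus.partialDeriv k ψ) :=
    (hψ.partialDeriv k).isContDiff (by simp)
  have hg : FunctionSpaces.Torus.IsContDiff 1
      (fun y => ⟪FunctionSpaces.Torus.partialDeriv k v y, FunctionSpaces.Torus.gradient φ y⟫_ℝ) :=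
    ((hv.partialDeriv k).inner hφ.gradient).isContDiff (by simp)
  have e : (fun y => FunctionSpaces.Torus.partialDeriv k ψ y -
      ⟪FunctionSpaces.Torus.partialDeriv k v y, FunctionSpaces.Torus.gradient φ y⟫_ℝ) =
      FunctionSpaces.Torus.partialDeriv k ψ -
        fun y => ⟪FunctionSpaces.Torus.partialDeriv k v y, FunctionSpaces.Torus.gradient φ y⟫_ℝ := rfl
  rw [e, FunctionSpaces.Torus.partialDeriv_sub hf hg, Pi.sub_apply,
    FunctionSpaces.Torus.partialDeriv_inner ((hv.partialDeriv k).isContDiff (by simp))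
      (hφ.gradient.isContDiff (by simp)),
    FunctionSpaces.Torus.partialDeriv_gradient_comm hφ]

/-- The pairing of `∂ᵢ∂ₖφ` with the second-order production, bounded: for smooth `φ`, `ψ`, `v` with
`‖∂ₖv‖ ≤ Λ`, `‖∂ᵢ∂ₖv‖ ≤ L₂` pointwise (`Λ, L₂ ≥ 0`),
`2 ∫ ∂ᵢ∂ₖφ · (∂ᵢ(∂ₖψ − ⟪∂ₖv, ∇φ⟫) − ⟪∂ᵢv, ∇∂ₖφ⟫)
  ≤ 2 ‖∂ᵢ∂ₖφ‖₂ (‖∂ᵢ∂ₖψ‖₂ + Λ‖∇∂ᵢφ‖₂ + L₂‖∇φ‖₂ + Λ‖∇∂ₖφ‖₂)`. [folklore] -/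
private theorem two_mul_integral_pdpd_mul_source_le {φ ψ : UnitAddTorus d → ℝ}
    {v : UnitAddTorus d → EuclideanSpace ℝ d} (hφ : FunctionSpaces.Torus.IsSmooth φ)
    (hψ : FunctionSpaces.Torus.IsSmooth ψ) (hv : FunctionSpaces.Torus.IsSmooth v) {Λ L₂ : ℝ}
    (hΛ : 0 ≤ Λ) (hL₂ : 0 ≤ L₂) (i k : d)
    (hL : ∀ x j, ‖FunctionSpaces.Torus.partialDeriv j v x‖ ≤ Λ)
    (hLL : ∀ x j l, ‖FunctionSpaces.Torus.partialDeriv j (FunctionSpaces.Torus.partialDeriv l v) x‖ ≤ L₂) :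
    2 * ∫ x, FunctionSpaces.Torus.partialDeriv i (FunctionSpaces.Torus.partialDeriv k φ) x *
        (FunctionSpaces.Torus.partialDeriv i (fun y => FunctionSpaces.Torus.partialDeriv k ψ y -
            ⟪FunctionSpaces.Torus.partialDeriv k v y, FunctionSpaces.Torus.gradient φ y⟫_ℝ) x -
          ⟪FunctionSpaces.Torus.partialDeriv i v x,
            FunctionSpaces.Torus.gradient (FunctionSpaces.Torus.partialDeriv k φ) x⟫_ℝ) ≤
      2 * Real.sqrt (∫ x, (FunctionSpaces.Torus.partialDeriv i (FunctionSpaces.Torus.partialDeriv k φ) x) ^ 2) *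
        (Real.sqrt (∫ x, (FunctionSpaces.Torus.partialDeriv i (FunctionSpaces.Torus.partialDeriv k ψ) x) ^ 2) +
          Λ * Real.sqrt (scalarGradNormSq (FunctionSpaces.Torus.partialDeriv i φ)) +
          L₂ * Real.sqrt (scalarGradNormSq φ) +
          Λ * Real.sqrt (scalarGradNormSq (FunctionSpaces.Torus.partialDeriv k φ))) := by
  -- names
  set Φ : UnitAddTorus d → ℝ := fun x =>
    FunctionSpaces.Torus.partialDeriv i (FunctionSpaces.Torus.partialDeriv k φ) x with hΦ
  set P : UnitAddTorus d → ℝ := fun x =>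
    FunctionSpaces.Torus.partialDeriv i (FunctionSpaces.Torus.partialDeriv k ψ) x with hP
  set I1 : UnitAddTorus d → ℝ := fun x => ⟪FunctionSpaces.Torus.partialDeriv k v x,
    FunctionSpaces.Torus.gradient (FunctionSpaces.Torus.partialDeriv i φ) x⟫_ℝ with hI1
  set I2 : UnitAddTorus d → ℝ := fun x => ⟪FunctionSpaces.Torus.partialDeriv i (FunctionSpaces.Torus.partialDeriv k v) x,
    FunctionSpaces.Torus.gradient φ x⟫_ℝ with hI2
  set I3 : UnitAddTorus d → ℝ := fun x => ⟪FunctionSpaces.Torus.partialDeriv i v x,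
    FunctionSpaces.Torus.gradient (FunctionSpaces.Torus.partialDeriv k φ) x⟫_ℝ with hI3
  set Z : UnitAddTorus d → ℝ := fun x => P x - I1 x - I2 x - I3 x with hZ
  have cΦ : Continuous Φ := ((hφ.partialDeriv k).partialDeriv i).continuous
  have cP : Continuous P := ((hψ.partialDeriv k).partialDeriv i).continuous
  have cW1 : Continuous (FunctionSpaces.Torus.gradient (FunctionSpaces.Torus.partialDeriv i φ)) :=
    (hφ.partialDeriv i).gradient.continuous
  have cW2 : Continuous (FunctionSpaces.Torus.gradient φ) := hφ.gradient.continuous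
  have cW3 : Continuous (FunctionSpaces.Torus.gradient (FunctionSpaces.Torus.partialDeriv k φ)) :=
    (hφ.partialDeriv k).gradient.continuous
  have cV1 : Continuous (FunctionSpaces.Torus.partialDeriv k v) := (hv.partialDeriv k).continuous
  have cV2 : Continuous (FunctionSpaces.Torus.partialDeriv i (FunctionSpaces.Torus.partialDeriv k v)) :=
    ((hv.partialDeriv k).partialDeriv i).continuous
  have cV3 : Continuous (FunctionSpaces.Torus.partialDeriv i v) := (hv.partialDeriv i).continuous
  have cI1 : Continuous I1 := cV1.inner cW1
  have cI2 : Continuous I2 := cV2.inner cW2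
  have cI3 : Continuous I3 := cV3.inner cW3
  have c12 : Continuous fun x => P x - I1 x := cP.sub cI1
  have c123 : Continuous fun x => P x - I1 x - I2 x := c12.sub cI2
  have cZ : Continuous Z := c123.sub cI3
  -- the integrand equals `Φ · Z`
  have hint : (fun x => FunctionSpaces.Torus.partialDeriv i (FunctionSpaces.Torus.partialDeriv k φ) x *
      (FunctionSpaces.Torus.partialDeriv i (fun y => FunctionSpaces.Torus.partialDeriv k ψ y -
          ⟪FunctionSpaces.Torus.partialDeriv k v y, FunctionSpaces.Torus.gradient φ y⟫_ℝ) x -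
        ⟪FunctionSpaces.Torus.partialDeriv i v x,
          FunctionSpaces.Torus.gradient (FunctionSpaces.Torus.partialDeriv k φ) x⟫_ℝ)) =
      fun x => Φ x * Z x := by
    funext x
    rw [partialDeriv_source_expand hφ hψ hv i k x, hΦ, hZ, hP, hI1, hI2, hI3]
    ring
  rw [hint]
  -- Cauchy–Schwarz and the triangle inequality for `‖Z‖₂`
  have hcs := Torus.integral_mul_le_sqrt_mul_sqrt cΦ cZ
  have hZle : Real.sqrt (∫ x, Z x ^ 2) ≤
      Real.sqrt (∫ x, P x ^ 2) + Λ * Real.sqrt (scalarGradNormSq (FunctionSpaces.Torus.partialDeriv i φ)) +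
        L₂ * Real.sqrt (scalarGradNormSq φ) +
        Λ * Real.sqrt (scalarGradNormSq (FunctionSpaces.Torus.partialDeriv k φ)) := by
    have t1 := sqrt_integral_sub_sq_le c123 cI3
    have t2 := sqrt_integral_sub_sq_le c12 cI2
    have t3 := sqrt_integral_sub_sq_le cP cI1
    have b1 := sqrt_integral_inner_sq_le cV1 cW1 hΛ (fun x => hL x k)
    have b2 := sqrt_integral_inner_sq_le cV2 cW2 hL₂ (fun x => hLL x i k)
    have b3 := sqrt_integral_inner_sq_le cV3 cW3 hΛ (fun x => hL x i)
    have e1 : ∫ x, ‖FunctionSpaces.Torus.gradient (FunctionSpaces.Torus.partialDeriv i φ) x‖ ^ 2 =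
        scalarGradNormSq (FunctionSpaces.Torus.partialDeriv i φ) := rfl
    have e2 : ∫ x, ‖FunctionSpaces.Torus.gradient φ x‖ ^ 2 = scalarGradNormSq φ := rfl
    have e3 : ∫ x, ‖FunctionSpaces.Torus.gradient (FunctionSpaces.Torus.partialDeriv k φ) x‖ ^ 2 =
        scalarGradNormSq (FunctionSpaces.Torus.partialDeriv k φ) := rfl
    rw [e1] at b1
    rw [e2] at b2
    rw [e3] at b3
    have hZdef : (fun x => Z x) = fun x => (P x - I1 x - I2 x) - I3 x := rfl
    calc Real.sqrt (∫ x, Z x ^ 2) = Real.sqrt (∫ x, ((P x - I1 x - I2 x) - I3 x) ^ 2) := rfl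
      _ ≤ Real.sqrt (∫ x, (P x - I1 x - I2 x) ^ 2) + Real.sqrt (∫ x, I3 x ^ 2) := t1
      _ ≤ (Real.sqrt (∫ x, (P x - I1 x) ^ 2) + Real.sqrt (∫ x, I2 x ^ 2)) + Real.sqrt (∫ x, I3 x ^ 2) := by
          gcongr
      _ ≤ ((Real.sqrt (∫ x, P x ^ 2) + Real.sqrt (∫ x, I1 x ^ 2)) + Real.sqrt (∫ x, I2 x ^ 2)) +
            Real.sqrt (∫ x, I3 x ^ 2) := by
          gcongr
      _ ≤ ((Real.sqrt (∫ x, P x ^ 2) +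
            Λ * Real.sqrt (scalarGradNormSq (FunctionSpaces.Torus.partialDeriv i φ))) +
            L₂ * Real.sqrt (scalarGradNormSq φ)) +
            Λ * Real.sqrt (scalarGradNormSq (FunctionSpaces.Torus.partialDeriv k φ)) := by
          gcongr
      _ = _ := by ring
  have hΦ0 : 0 ≤ Real.sqrt (∫ x, Φ x ^ 2) := Real.sqrt_nonneg _
  calc 2 * ∫ x, Φ x * Z x ≤ 2 * (Real.sqrt (∫ x, Φ x ^ 2) * Real.sqrt (∫ x, Z x ^ 2)) := by linarith
    _ ≤ 2 * (Real.sqrt (∫ x, Φ x ^ 2) *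
        (Real.sqrt (∫ x, P x ^ 2) + Λ * Real.sqrt (scalarGradNormSq (FunctionSpaces.Torus.partialDeriv i φ)) +
          L₂ * Real.sqrt (scalarGradNormSq φ) +
          Λ * Real.sqrt (scalarGradNormSq (FunctionSpaces.Torus.partialDeriv k φ)))) := by
        gcongr
    _ = _ := by rw [hΦ, hP]; ring

/-- **Hessian growth for the forced transport–diffusion equation, uniformly in `κ ≥ 0`.** Let `θ`
solve `∂ₜθ + u·∇θ = κΔθ + s`, `div u = 0`, classically on `S ⊇ [a, b]`, with, for all `τ ∈ [a, b]`
and `x`: `‖∂ₖu‖ ≤ Λ`, `‖∂ᵢ∂ₖu‖ ≤ L₂` (`Λ, L₂ ≥ 0`), `‖∇θ(τ)‖_{L²} ≤ Y(τ)` (`Y` continuous — e.g. the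
bound of `sqrt_scalarGradNormSq_le_exp`) and `(∑ᵢₖ ‖∂ᵢ∂ₖs(τ)‖₂²)^{1/2} ≤ G(τ)` (`G ≥ 0` continuous). Then
for `t ∈ [a, b]`, with `d = card d`,
`(∑ᵢₖ ‖∂ᵢ∂ₖθ(t)‖₂²)^{1/2} ≤ e^{2d²Λ(t−a)} ((∑ᵢₖ ‖∂ᵢ∂ₖθ(a)‖₂²)^{1/2} + ∫ₐᵗ (d²L₂Y + G))`:
each `∂ᵢ∂ₖθ` solves the equation with source `∂ᵢ∂ₖs − ⟪∂ᵢ∂ₖu, ∇θ⟫ − ⟪∂ₖu, ∇∂ᵢθ⟫ − ⟪∂ᵢu, ∇∂ₖθ⟫`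
(`partialDeriv` twice), the diffusion is dropped with its sign, the production is paid by Cauchy–Schwarz
with `‖∇∂ᵢθ‖₂, ‖∂ᵢ∂ₖθ‖₂ ≤ (∑‖∂∂θ‖₂²)^{1/2}`, and the weighted comparison lemma closes. The
prescribed-drift case of the `H^m` energy estimate, `m = 2`, constants displayed; no `κ⁻¹`.
[cite: MajdaBertozzi2002, §3.2 Prop. 3.7 (3.58)–(3.60) (the H^m energy estimate, uniform in the viscosity; here m = 2, prescribed drift)] -/
theorem sqrt_hessSq_le_exp {S : Set ℝ} (h : IsClassicalScalarTransportForcedOn S κ u s θ)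
    (hκ : 0 ≤ κ) {a b : ℝ} (hI : Icc a b ⊆ S) {Λ L₂ : ℝ} (hΛ : 0 ≤ Λ) (hL₂ : 0 ≤ L₂)
    (hL : ∀ τ ∈ Icc a b, ∀ x, ∀ k, ‖FunctionSpaces.Torus.partialDeriv k (u τ) x‖ ≤ Λ)
    (hLL : ∀ τ ∈ Icc a b, ∀ x, ∀ i k,
      ‖FunctionSpaces.Torus.partialDeriv i (FunctionSpaces.Torus.partialDeriv k (u τ)) x‖ ≤ L₂)
    {Y : ℝ → ℝ} (hYc : ContinuousOn Y (Icc a b))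
    (hY : ∀ τ ∈ Icc a b, Real.sqrt (scalarGradNormSq (θ τ)) ≤ Y τ)
    {G : ℝ → ℝ} (hGc : ContinuousOn G (Icc a b)) (hG0 : ∀ τ ∈ Icc a b, 0 ≤ G τ)
    (hsG : ∀ τ ∈ Icc a b, Real.sqrt (∑ i, ∑ k, ∫ x,
      (FunctionSpaces.Torus.partialDeriv i (FunctionSpaces.Torus.partialDeriv k (s τ)) x) ^ 2) ≤ G τ)
    {t : ℝ} (ht : t ∈ Icc a b) :
    Real.sqrt (∑ i, ∑ k, ∫ x,
        (FunctionSpaces.Torus.partialDeriv i (FunctionSpaces.Torus.partialDeriv k (θ t)) x) ^ 2) ≤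
      Real.exp (2 * (Fintype.card d : ℝ) ^ 2 * Λ * (t - a)) *
        (Real.sqrt (∑ i, ∑ k, ∫ x,
            (FunctionSpaces.Torus.partialDeriv i (FunctionSpaces.Torus.partialDeriv k (θ a)) x) ^ 2) +
          ∫ τ in a..t, ((Fintype.card d : ℝ) ^ 2 * L₂ * Y τ + G τ)) := by
  rcases eq_or_lt_of_le ht.1 with rfl | hat
  · simp
  have hsub : Icc a t ⊆ Icc a b := Icc_subset_Icc_right ht.2
  have h' := h.restrict_Icc hat (hsub.trans hI)
  have hik := fun i k => (h'.partialDeriv hat k).partialDeriv hat i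
  set E : ℝ → ℝ := fun τ => ∑ i, ∑ k, ∫ x,
    (FunctionSpaces.Torus.partialDeriv i (FunctionSpaces.Torus.partialDeriv k (θ τ)) x) ^ 2 with hE
  -- the per-`(i,k)` right-hand sides of the `L²` balances, in the literal form of `partialDeriv`
  set term : d → d → ℝ → ℝ := fun i k τ =>
    -(2 * κ * ∫ x, ‖FunctionSpaces.Torus.gradient
        (FunctionSpaces.Torus.partialDeriv i (FunctionSpaces.Torus.partialDeriv k (θ τ))) x‖ ^ 2) +
      2 * ∫ x, FunctionSpaces.Torus.partialDeriv i (FunctionSpaces.Torus.partialDeriv k (θ τ)) x *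
        (FunctionSpaces.Torus.partialDeriv i (fun y => FunctionSpaces.Torus.partialDeriv k (s τ) y -
            ⟪FunctionSpaces.Torus.partialDeriv k (u τ) y, FunctionSpaces.Torus.gradient (θ τ) y⟫_ℝ) x -
          ⟪FunctionSpaces.Torus.partialDeriv i (u τ) x,
            FunctionSpaces.Torus.gradient (FunctionSpaces.Torus.partialDeriv k (θ τ)) x⟫_ℝ) with hterm
  set D : ℝ → ℝ := fun τ => ∑ i, ∑ k, term i k τ with hD
  have hEd : ∀ τ ∈ Icc a t, HasDerivWithinAt E (D τ) (Icc a t) τ := by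
    intro τ hτ
    exact HasDerivWithinAt.fun_sum (u := Finset.univ) fun i _ =>
      HasDerivWithinAt.fun_sum (u := Finset.univ) fun k _ =>
        (hik i k).hasDerivWithinAt_integral_sq (convex_Icc a t) hτ
  have hDc : ContinuousOn D (Icc a t) :=
    continuousOn_finsetSum _ fun i _ => continuousOn_finsetSum _ fun k _ =>
      (hik i k).continuousOn_integral_sq_deriv (convex_Icc a t) (uniqueDiffOn_Icc hat)
  have hEpos : ∀ τ ∈ Icc a t, 0 ≤ E τ := fun τ _ =>
    Finset.sum_nonneg fun i _ => Finset.sum_nonneg fun k _ => integral_nonneg fun x => sq_nonneg _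
  have hY0 : ∀ τ ∈ Icc a b, 0 ≤ Y τ := fun τ hτ => (Real.sqrt_nonneg _).trans (hY τ hτ)
  set G' : ℝ → ℝ := fun τ => (Fintype.card d : ℝ) ^ 2 * L₂ * Y τ + G τ with hG'
  have hG'c : ContinuousOn G' (Icc a t) :=
    ((continuousOn_const.mul (hYc.mono hsub)).add (hGc.mono hsub))
  have hG'0 : ∀ τ ∈ Icc a t, 0 ≤ G' τ := fun τ hτ =>
    add_nonneg (mul_nonneg (mul_nonneg (sq_nonneg _) hL₂) (hY0 τ (hsub hτ))) (hG0 τ (hsub hτ))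
  have hle : ∀ τ ∈ Icc a t, D τ ≤
      2 * Real.sqrt (E τ) * (2 * (Fintype.card d : ℝ) ^ 2 * Λ * Real.sqrt (E τ) + G' τ) := by
    intro τ hτ
    have hθτ : FunctionSpaces.Torus.IsSmooth (θ τ) := h'.smooth_scalar.isSmooth_slice hτ
    have hsτ : FunctionSpaces.Torus.IsSmooth (s τ) := h'.smooth_source.isSmooth_slice hτ
    have huτ : FunctionSpaces.Torus.IsSmooth (u τ) := h'.smooth_velocity.isSmooth_slice hτ
    set A : d → d → ℝ := fun i k => Real.sqrt (∫ x,
      (FunctionSpaces.Torus.partialDeriv i (FunctionSpaces.Torus.partialDeriv k (θ τ)) x) ^ 2) with hA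
    set B : d → d → ℝ := fun i k => Real.sqrt (∫ x,
      (FunctionSpaces.Torus.partialDeriv i (FunctionSpaces.Torus.partialDeriv k (s τ)) x) ^ 2) with hB
    set C : d → ℝ := fun i => Real.sqrt (scalarGradNormSq (FunctionSpaces.Torus.partialDeriv i (θ τ))) with hC
    have hA2 : ∑ i, ∑ k, A i k ^ 2 = E τ := by
      refine Finset.sum_congr rfl fun i _ => Finset.sum_congr rfl fun k _ => ?_
      exact Real.sq_sqrt (integral_nonneg fun x => sq_nonneg _)
    have hB2 : ∑ i, ∑ k, B i k ^ 2 = ∑ i, ∑ k, ∫ x,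
        (FunctionSpaces.Torus.partialDeriv i (FunctionSpaces.Torus.partialDeriv k (s τ)) x) ^ 2 := by
      refine Finset.sum_congr rfl fun i _ => Finset.sum_congr rfl fun k _ => ?_
      exact Real.sq_sqrt (integral_nonneg fun x => sq_nonneg _)
    have hAle : ∀ i k, A i k ≤ Real.sqrt (E τ) := fun i k =>
      Real.sqrt_le_sqrt (integral_partialDeriv_partialDeriv_sq_le_sum (θ τ) i k)
    have hCle : ∀ i, C i ≤ Real.sqrt (E τ) := fun i =>
      Real.sqrt_le_sqrt (scalarGradNormSq_partialDeriv_le_sum hθτ i)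
    have hYτ := hY τ (hsub hτ)
    have hE0 : 0 ≤ Real.sqrt (E τ) := Real.sqrt_nonneg _
    have hA0 : ∀ i k, 0 ≤ A i k := fun i k => Real.sqrt_nonneg _
    -- per-(i,k) bound
    have hterm_le : ∀ i k, term i k τ ≤
        2 * A i k * B i k + 2 * ((Fintype.card d : ℝ) ^ 0 * L₂ * Y τ) * A i k +
          4 * Λ * (A i k * Real.sqrt (E τ)) := by
      intro i k
      have i1 : -(2 * κ * ∫ x, ‖FunctionSpaces.Torus.gradient
          (FunctionSpaces.Torus.partialDeriv i (FunctionSpaces.Torus.partialDeriv k (θ τ))) x‖ ^ 2) ≤ 0 := by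
        have : 0 ≤ ∫ x, ‖FunctionSpaces.Torus.gradient
            (FunctionSpaces.Torus.partialDeriv i (FunctionSpaces.Torus.partialDeriv k (θ τ))) x‖ ^ 2 :=
          integral_nonneg fun x => sq_nonneg _
        nlinarith
      have i2 := two_mul_integral_pdpd_mul_source_le hθτ hsτ huτ hΛ hL₂ i k
        (fun x j => hL τ (hsub hτ) x j) (fun x j l => hLL τ (hsub hτ) x j l)
      have hCi := hCle i
      have hCk := hCle k
      have hsg : Real.sqrt (scalarGradNormSq (θ τ)) ≤ Y τ := hYτ
      have hAik := hA0 i k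
      have e : term i k τ = -(2 * κ * ∫ x, ‖FunctionSpaces.Torus.gradient
          (FunctionSpaces.Torus.partialDeriv i (FunctionSpaces.Torus.partialDeriv k (θ τ))) x‖ ^ 2) +
        2 * ∫ x, FunctionSpaces.Torus.partialDeriv i (FunctionSpaces.Torus.partialDeriv k (θ τ)) x *
          (FunctionSpaces.Torus.partialDeriv i (fun y => FunctionSpaces.Torus.partialDeriv k (s τ) y -
              ⟪FunctionSpaces.Torus.partialDeriv k (u τ) y, FunctionSpaces.Torus.gradient (θ τ) y⟫_ℝ) x -
            ⟪FunctionSpaces.Torus.partialDeriv i (u τ) x,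
              FunctionSpaces.Torus.gradient (FunctionSpaces.Torus.partialDeriv k (θ τ)) x⟫_ℝ) := rfl
      rw [e, pow_zero, one_mul]
      have hprod1 : A i k * (Λ * C i) ≤ A i k * (Λ * Real.sqrt (E τ)) :=
        mul_le_mul_of_nonneg_left (mul_le_mul_of_nonneg_left hCi hΛ) hAik
      have hprod2 : A i k * (Λ * C k) ≤ A i k * (Λ * Real.sqrt (E τ)) :=
        mul_le_mul_of_nonneg_left (mul_le_mul_of_nonneg_left hCk hΛ) hAik
      have hprod3 : A i k * (L₂ * Real.sqrt (scalarGradNormSq (θ τ))) ≤ A i k * (L₂ * Y τ) :=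
        mul_le_mul_of_nonneg_left (mul_le_mul_of_nonneg_left hsg hL₂) hAik
      nlinarith [i1, i2, hprod1, hprod2, hprod3]
    have hsum := Finset.sum_le_sum fun i (_ : i ∈ Finset.univ) =>
      Finset.sum_le_sum fun k (_ : k ∈ Finset.univ) => hterm_le i k
    -- sum the three pieces
    have hAB : ∑ i, ∑ k, A i k * B i k ≤ Real.sqrt (E τ) * G τ := by
      calc ∑ i, ∑ k, A i k * B i k ≤ Real.sqrt (∑ i, ∑ k, A i k ^ 2) * Real.sqrt (∑ i, ∑ k, B i k ^ 2) :=
            sum_sum_mul_le_sqrt_mul_sqrt A B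
        _ = Real.sqrt (E τ) * Real.sqrt (∑ i, ∑ k, ∫ x,
              (FunctionSpaces.Torus.partialDeriv i (FunctionSpaces.Torus.partialDeriv k (s τ)) x) ^ 2) := by
            rw [hA2, hB2]
        _ ≤ Real.sqrt (E τ) * G τ := mul_le_mul_of_nonneg_left (hsG τ (hsub hτ)) hE0
    have hAsum : ∑ i, ∑ k, A i k ≤ (Fintype.card d : ℝ) ^ 2 * Real.sqrt (E τ) := by
      calc ∑ i, ∑ k, A i k ≤ ∑ _i : d, ∑ _k : d, Real.sqrt (E τ) :=
            Finset.sum_le_sum fun i _ => Finset.sum_le_sum fun k _ => hAle i k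
        _ = (Fintype.card d : ℝ) ^ 2 * Real.sqrt (E τ) := by
            rw [Finset.sum_const, Finset.card_univ, Finset.sum_const, Finset.card_univ, nsmul_eq_mul,
              nsmul_eq_mul]
            ring
    have hAEsum : ∑ i, ∑ k, A i k * Real.sqrt (E τ) ≤ (Fintype.card d : ℝ) ^ 2 * Real.sqrt (E τ) * Real.sqrt (E τ) := by
      rw [show (∑ i, ∑ k, A i k * Real.sqrt (E τ)) = (∑ i, ∑ k, A i k) * Real.sqrt (E τ) by
        rw [Finset.sum_mul]; refine Finset.sum_congr rfl fun i _ => ?_; rw [Finset.sum_mul]]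
      exact mul_le_mul_of_nonneg_right hAsum hE0
    have hrhs : ∑ i, ∑ k, (2 * A i k * B i k + 2 * ((Fintype.card d : ℝ) ^ 0 * L₂ * Y τ) * A i k +
        4 * Λ * (A i k * Real.sqrt (E τ))) =
        2 * (∑ i, ∑ k, A i k * B i k) + 2 * (L₂ * Y τ) * (∑ i, ∑ k, A i k) +
          4 * Λ * (∑ i, ∑ k, A i k * Real.sqrt (E τ)) := by
      simp only [Finset.sum_add_distrib, Finset.mul_sum, pow_zero, one_mul]
      refine congrArg₂ _ (congrArg₂ _ (Finset.sum_congr rfl fun i _ => Finset.sum_congr rfl fun k _ => by ring) rfl) rfl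
    rw [hrhs] at hsum
    have hDτ : D τ = ∑ i, ∑ k, term i k τ := rfl
    rw [hDτ]
    have hsq : Real.sqrt (E τ) * Real.sqrt (E τ) = E τ := Real.mul_self_sqrt (hEpos τ hτ)
    have hG := hG0 τ (hsub hτ)
    have hYp := hY0 τ (hsub hτ)
    have hG'τ : G' τ = (Fintype.card d : ℝ) ^ 2 * L₂ * Y τ + G τ := rfl
    rw [hG'τ]
    have hcard : (0 : ℝ) ≤ (Fintype.card d : ℝ) ^ 2 := sq_nonneg _
    nlinarith [hsum, hAB, hAsum, hAEsum, hE0, mul_nonneg hΛ hE0, mul_nonneg hL₂ hYp,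
      mul_nonneg (mul_nonneg hcard (mul_nonneg hL₂ hYp)) hE0]
  have hΛ' : 0 ≤ 2 * (Fintype.card d : ℝ) ^ 2 * Λ := by positivity
  have key := ForcedGradientGrowth.sqrt_le_exp_mul_Icc (Λ := 2 * (Fintype.card d : ℝ) ^ 2 * Λ) hat.le hΛ'
    hEd hDc hEpos hle hG'0 hG'c
  exact key

end IsClassicalScalarTransportForcedOn

/-! ### From the Hessian to the Laplacian -/

/-- **`‖Δφ‖²_{L²} ≤ d · ∑ᵢₖ ‖∂ᵢ∂ₖφ‖²_{L²}`** for smooth `φ` on `T^d` (`Δφ = ∑ᵢ ∂ᵢ∂ᵢφ` and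
Cauchy–Schwarz for the finite sum; the diagonal is part of the double sum) — to convert the Hessian
bound of `IsClassicalScalarTransportForcedOn.sqrt_hessSq_le_exp` into a bound on `‖Δφ‖₂` (for the
planar linearised vorticity `ω`, `‖Δω‖₂ = ‖∇Δw‖₂`).
[cite: Evans2010, App. B.2 (Cauchy–Schwarz inequality, finite sums)] -/
theorem integral_laplacian_sq_le_card_mul_sum {φ : UnitAddTorus d → ℝ} (hφ : FunctionSpaces.Torus.IsSmooth φ) :
    ∫ x, (FunctionSpaces.Torus.laplacian φ x) ^ 2 ≤
      Fintype.card d * ∑ i, ∑ k, ∫ x,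
        (FunctionSpaces.Torus.partialDeriv i (FunctionSpaces.Torus.partialDeriv k φ) x) ^ 2 := by
  have hpt : ∀ x, (FunctionSpaces.Torus.laplacian φ x) ^ 2 ≤
      Fintype.card d * ∑ i, (FunctionSpaces.Torus.partialDeriv i (FunctionSpaces.Torus.partialDeriv i φ) x) ^ 2 := by
    intro x
    rw [FunctionSpaces.Torus.laplacian_eq_sum_partialDeriv_partialDeriv hφ x]
    have h := Finset.sum_mul_sq_le_sq_mul_sq Finset.univ
      (fun i => FunctionSpaces.Torus.partialDeriv i (FunctionSpaces.Torus.partialDeriv i φ) x)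
      (fun _ => (1 : ℝ))
    simp only [mul_one, one_pow, Finset.sum_const, Finset.card_univ, nsmul_eq_mul] at h
    linarith
  have ci : ∀ i k, Continuous fun x =>
      (FunctionSpaces.Torus.partialDeriv i (FunctionSpaces.Torus.partialDeriv k φ) x) ^ 2 := fun i k =>
    (((hφ.partialDeriv k).partialDeriv i).continuous).pow 2
  have i1 : Integrable (fun x => (FunctionSpaces.Torus.laplacian φ x) ^ 2) volume :=
    (hφ.laplacian.continuous.pow 2).integrable_unitAddTorus
  have i2 : Integrable (fun x => (Fintype.card d : ℝ) * ∑ i,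
      (FunctionSpaces.Torus.partialDeriv i (FunctionSpaces.Torus.partialDeriv i φ) x) ^ 2) volume :=
    (continuous_const.mul (continuous_finsetSum _ fun i _ => ci i i)).integrable_unitAddTorus
  calc ∫ x, (FunctionSpaces.Torus.laplacian φ x) ^ 2
      ≤ ∫ x, (Fintype.card d : ℝ) * ∑ i,
          (FunctionSpaces.Torus.partialDeriv i (FunctionSpaces.Torus.partialDeriv i φ) x) ^ 2 :=
        integral_mono i1 i2 hpt
    _ = Fintype.card d * ∑ i, ∫ x,
          (FunctionSpaces.Torus.partialDeriv i (FunctionSpaces.Torus.partialDeriv i φ) x) ^ 2 := by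
        rw [integral_const_mul, integral_finsetSum _ fun i _ => (ci i i).integrable_unitAddTorus]
    _ ≤ Fintype.card d * ∑ i, ∑ k, ∫ x,
          (FunctionSpaces.Torus.partialDeriv i (FunctionSpaces.Torus.partialDeriv k φ) x) ^ 2 := by
        refine mul_le_mul_of_nonneg_left ?_ (Nat.cast_nonneg _)
        refine Finset.sum_le_sum fun i _ => ?_
        exact Finset.single_le_sum
          (f := fun k => ∫ x, (FunctionSpaces.Torus.partialDeriv i (FunctionSpaces.Torus.partialDeriv k φ) x) ^ 2)
          (fun k _ => integral_nonneg fun x => sq_nonneg _) (Finset.mem_univ i)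

/-! ### Sources of product form `s = ρ · f`

For the cascade the vorticity source is `s = rate · U″(x₂) · w₁` (`SawtoothCascadeResponseVorticity`):
a smooth coefficient times a component of the response. The `L²` norms of `∇s` and `∇²s` that the
`H¹`/`H²` levels consume are bounded by sup norms of `ρ, ∇ρ, ∇²ρ` times `‖f‖₂, ‖∇f‖₂, ‖∇²f‖₂`. -/

namespace ForcedGradientGrowth

omit [DecidableEq d] in
/-- `‖h‖₂ ≤ R‖g‖₂` when `|h| ≤ R|g|` pointwise (continuous `h`, `g`, `R ≥ 0`). [folklore] -/
private theorem sqrt_integral_sq_le_of_abs_le {h g : UnitAddTorus d → ℝ} (hh : Continuous h)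
    (hg : Continuous g) {R : ℝ} (hR : 0 ≤ R) (hle : ∀ x, |h x| ≤ R * |g x|) :
    Real.sqrt (∫ x, h x ^ 2) ≤ R * Real.sqrt (∫ x, g x ^ 2) := by
  have i1 : Integrable (fun x => h x ^ 2) volume := (hh.pow 2).integrable_unitAddTorus
  have i2 : Integrable (fun x => R ^ 2 * g x ^ 2) volume :=
    (continuous_const.mul (hg.pow 2)).integrable_unitAddTorus
  have hmono : ∫ x, h x ^ 2 ≤ ∫ x, R ^ 2 * g x ^ 2 := by
    refine integral_mono i1 i2 fun x => ?_
    have h1 := hle x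
    calc h x ^ 2 = |h x| ^ 2 := (sq_abs _).symm
      _ ≤ (R * |g x|) ^ 2 := pow_le_pow_left₀ (abs_nonneg _) h1 2
      _ = R ^ 2 * g x ^ 2 := by rw [mul_pow, sq_abs]
  calc Real.sqrt (∫ x, h x ^ 2) ≤ Real.sqrt (∫ x, R ^ 2 * g x ^ 2) := Real.sqrt_le_sqrt hmono
    _ = R * Real.sqrt (∫ x, g x ^ 2) := by
        rw [integral_const_mul, Real.sqrt_mul (sq_nonneg _), Real.sqrt_sq hR]

omit [Fintype d] [DecidableEq d] in
/-- Minkowski's inequality for finite sums of squares. [folklore] -/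
private theorem sqrt_sum_sq_add_le {ι : Type*} [Fintype ι] (x y : ι → ℝ) :
    Real.sqrt (∑ i, (x i + y i) ^ 2) ≤ Real.sqrt (∑ i, x i ^ 2) + Real.sqrt (∑ i, y i ^ 2) := by
  have hX : 0 ≤ Real.sqrt (∑ i, x i ^ 2) := Real.sqrt_nonneg _
  have hY : 0 ≤ Real.sqrt (∑ i, y i ^ 2) := Real.sqrt_nonneg _
  have hx2 : 0 ≤ ∑ i, x i ^ 2 := Finset.sum_nonneg fun i _ => sq_nonneg _
  have hy2 : 0 ≤ ∑ i, y i ^ 2 := Finset.sum_nonneg fun i _ => sq_nonneg _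
  have hcs := Real.sum_mul_le_sqrt_mul_sqrt Finset.univ x y
  have hexp : ∑ i, (x i + y i) ^ 2 = ∑ i, x i ^ 2 + 2 * ∑ i, x i * y i + ∑ i, y i ^ 2 := by
    rw [Finset.mul_sum, ← Finset.sum_add_distrib, ← Finset.sum_add_distrib]
    exact Finset.sum_congr rfl fun i _ => by ring
  have key : ∑ i, (x i + y i) ^ 2 ≤ (Real.sqrt (∑ i, x i ^ 2) + Real.sqrt (∑ i, y i ^ 2)) ^ 2 := by
    rw [hexp, add_sq, Real.sq_sqrt hx2, Real.sq_sqrt hy2]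
    nlinarith [hcs]
  calc Real.sqrt (∑ i, (x i + y i) ^ 2)
      ≤ Real.sqrt ((Real.sqrt (∑ i, x i ^ 2) + Real.sqrt (∑ i, y i ^ 2)) ^ 2) := Real.sqrt_le_sqrt key
    _ = Real.sqrt (∑ i, x i ^ 2) + Real.sqrt (∑ i, y i ^ 2) := Real.sqrt_sq (add_nonneg hX hY)

omit [Fintype d] [DecidableEq d] in
/-- Monotonicity of `(∑ uᵢ²)^{1/2}` for `0 ≤ uᵢ ≤ vᵢ`. [folklore] -/
private theorem sqrt_sum_sq_le_sqrt_sum_sq {ι : Type*} [Fintype ι] {u v : ι → ℝ} (hu : ∀ i, 0 ≤ u i)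
    (hle : ∀ i, u i ≤ v i) : Real.sqrt (∑ i, u i ^ 2) ≤ Real.sqrt (∑ i, v i ^ 2) :=
  Real.sqrt_le_sqrt (Finset.sum_le_sum fun i _ => pow_le_pow_left₀ (hu i) (hle i) 2)

omit [Fintype d] [DecidableEq d] in
/-- `(∑ (c zᵢ)²)^{1/2} = c (∑ zᵢ²)^{1/2}` for `c ≥ 0`. [folklore] -/
private theorem sqrt_sum_mul_sq {ι : Type*} [Fintype ι] (z : ι → ℝ) {c : ℝ} (hc : 0 ≤ c) :
    Real.sqrt (∑ i, (c * z i) ^ 2) = c * Real.sqrt (∑ i, z i ^ 2) := by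
  have : ∑ i, (c * z i) ^ 2 = c ^ 2 * ∑ i, z i ^ 2 := by
    rw [Finset.mul_sum]
    exact Finset.sum_congr rfl fun i _ => by ring
  rw [this, Real.sqrt_mul (sq_nonneg _), Real.sqrt_sq hc]

omit [Fintype d] [DecidableEq d] in
/-- `(∑ᵢ c²)^{1/2} = √(card) · c` for `c ≥ 0`. [folklore] -/
private theorem sqrt_sum_const_sq {ι : Type*} [Fintype ι] {c : ℝ} (hc : 0 ≤ c) :
    Real.sqrt (∑ _i : ι, c ^ 2) = Real.sqrt (Fintype.card ι) * c := by
  rw [Finset.sum_const, Finset.card_univ, nsmul_eq_mul, Real.sqrt_mul (Nat.cast_nonneg _), Real.sqrt_sq hc]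

end ForcedGradientGrowth

open ForcedGradientGrowth in
/-- **Gradient of a product source.** For smooth `ρ`, `f` on `T^d` with `|ρ| ≤ R₀` and
`|∂ₖρ| ≤ R₁` pointwise (`R₀, R₁ ≥ 0`):
`‖∇(ρf)‖₂ ≤ R₀ ‖∇f‖₂ + √d · R₁ ‖f‖₂` (`∂ₖ(ρf) = ρ∂ₖf + (∂ₖρ)f`, Minkowski).
[cite: Evans2010, §5.2.3 Thm. 1 (iv) (Leibniz rule for products) with App. B.2 (Cauchy–Schwarz)] -/
theorem sqrt_scalarGradNormSq_mul_le {ρ f : UnitAddTorus d → ℝ} (hρ : FunctionSpaces.Torus.IsSmooth ρ)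
    (hf : FunctionSpaces.Torus.IsSmooth f) {R₀ R₁ : ℝ} (hR₀ : 0 ≤ R₀) (hR₁ : 0 ≤ R₁)
    (h0 : ∀ x, |ρ x| ≤ R₀) (h1 : ∀ x k, |FunctionSpaces.Torus.partialDeriv k ρ x| ≤ R₁) :
    Real.sqrt (scalarGradNormSq (fun x => ρ x * f x)) ≤
      R₀ * Real.sqrt (scalarGradNormSq f) +
        Real.sqrt (Fintype.card d) * R₁ * Real.sqrt (∫ x, f x ^ 2) := by
  have hρf : FunctionSpaces.Torus.IsSmooth (fun x => ρ x * f x) := hρ.smul' hf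
  rw [IsClassicalScalarTransportForcedOn.scalarGradNormSq_eq_sum hρf,
    IsClassicalScalarTransportForcedOn.scalarGradNormSq_eq_sum hf]
  set a : d → ℝ := fun k =>
    Real.sqrt (∫ x, (FunctionSpaces.Torus.partialDeriv k (fun x => ρ x * f x) x) ^ 2) with ha
  set c : d → ℝ := fun k => Real.sqrt (∫ x, (FunctionSpaces.Torus.partialDeriv k f x) ^ 2) with hc
  set b : ℝ := Real.sqrt (∫ x, f x ^ 2) with hb
  have hak : ∀ k, a k ≤ R₀ * c k + R₁ * b := by
    intro k
    have e' : ∀ x, FunctionSpaces.Torus.partialDeriv k (fun x => ρ x * f x) x =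
        ρ x * FunctionSpaces.Torus.partialDeriv k f x + FunctionSpaces.Torus.partialDeriv k ρ x * f x :=
      fun x => FunctionSpaces.Torus.partialDeriv_mul (hρ.isContDiff (by simp)) (hf.isContDiff (by simp)) k x
    have cA : Continuous fun x => ρ x * FunctionSpaces.Torus.partialDeriv k f x :=
      hρ.continuous.mul (hf.partialDeriv k).continuous
    have cB : Continuous fun x => FunctionSpaces.Torus.partialDeriv k ρ x * f x :=
      (hρ.partialDeriv k).continuous.mul hf.continuous
    have t := Torus.sqrt_integral_add_sq_le cA cB
    have bA := sqrt_integral_sq_le_of_abs_le cA (hf.partialDeriv k).continuous hR₀ (fun x => by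
      rw [abs_mul]; exact mul_le_mul_of_nonneg_right (h0 x) (abs_nonneg _))
    have bB := sqrt_integral_sq_le_of_abs_le cB hf.continuous hR₁ (fun x => by
      rw [abs_mul]; exact mul_le_mul_of_nonneg_right (h1 x k) (abs_nonneg _))
    have ea : a k = Real.sqrt (∫ x, (ρ x * FunctionSpaces.Torus.partialDeriv k f x +
        FunctionSpaces.Torus.partialDeriv k ρ x * f x) ^ 2) := by
      simp only [ha, e']
    rw [ea]
    simp only [hc, hb]
    linarith [t, bA, bB]
  have ha0 : ∀ k, 0 ≤ a k := fun k => Real.sqrt_nonneg _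
  have hsum_a : Real.sqrt (∑ k, ∫ x, (FunctionSpaces.Torus.partialDeriv k (fun x => ρ x * f x) x) ^ 2) =
      Real.sqrt (∑ k, a k ^ 2) := by
    congr 1
    exact Finset.sum_congr rfl fun k _ => (Real.sq_sqrt (integral_nonneg fun x => sq_nonneg _)).symm
  have hsum_c : Real.sqrt (∑ k, ∫ x, (FunctionSpaces.Torus.partialDeriv k f x) ^ 2) =
      Real.sqrt (∑ k, c k ^ 2) := by
    congr 1
    exact Finset.sum_congr rfl fun k _ => (Real.sq_sqrt (integral_nonneg fun x => sq_nonneg _)).symm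
  rw [hsum_a, hsum_c]
  have hb0 : 0 ≤ R₁ * b := mul_nonneg hR₁ (Real.sqrt_nonneg _)
  calc Real.sqrt (∑ k, a k ^ 2) ≤ Real.sqrt (∑ k, (R₀ * c k + R₁ * b) ^ 2) :=
        sqrt_sum_sq_le_sqrt_sum_sq ha0 hak
    _ ≤ Real.sqrt (∑ k, (R₀ * c k) ^ 2) + Real.sqrt (∑ _k : d, (R₁ * b) ^ 2) :=
        sqrt_sum_sq_add_le (fun k => R₀ * c k) (fun _ => R₁ * b)
    _ = R₀ * Real.sqrt (∑ k, c k ^ 2) + Real.sqrt (Fintype.card d) * (R₁ * b) := by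
        rw [sqrt_sum_mul_sq c hR₀, sqrt_sum_const_sq hb0]
    _ = _ := by rw [hb]; ring

open ForcedGradientGrowth in
/-- **Hessian of a product source.** For smooth `ρ`, `f` on `T^d` with `|ρ| ≤ R₀`, `|∂ₖρ| ≤ R₁`,
`|∂ᵢ∂ₖρ| ≤ R₂` pointwise (`R₀, R₁, R₂ ≥ 0`):
`(∑ᵢₖ ‖∂ᵢ∂ₖ(ρf)‖₂²)^{1/2} ≤ R₀ (∑ᵢₖ ‖∂ᵢ∂ₖf‖₂²)^{1/2} + 2√d · R₁ ‖∇f‖₂ + d · R₂ ‖f‖₂`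
(`∂ᵢ∂ₖ(ρf) = ρ∂ᵢ∂ₖf + ∂ᵢρ∂ₖf + ∂ₖρ∂ᵢf + (∂ᵢ∂ₖρ)f`, Minkowski).
[cite: Evans2010, §5.2.3 Thm. 1 (iv) (Leibniz rule for products) with App. B.2 (Cauchy–Schwarz)] -/
theorem sqrt_sum_partialDeriv_partialDeriv_mul_sq_le {ρ f : UnitAddTorus d → ℝ}
    (hρ : FunctionSpaces.Torus.IsSmooth ρ) (hf : FunctionSpaces.Torus.IsSmooth f) {R₀ R₁ R₂ : ℝ}
    (hR₀ : 0 ≤ R₀) (hR₁ : 0 ≤ R₁) (hR₂ : 0 ≤ R₂) (h0 : ∀ x, |ρ x| ≤ R₀)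
    (h1 : ∀ x k, |FunctionSpaces.Torus.partialDeriv k ρ x| ≤ R₁)
    (h2 : ∀ x i k, |FunctionSpaces.Torus.partialDeriv i (FunctionSpaces.Torus.partialDeriv k ρ) x| ≤ R₂) :
    Real.sqrt (∑ i, ∑ k, ∫ x, (FunctionSpaces.Torus.partialDeriv i
        (FunctionSpaces.Torus.partialDeriv k (fun x => ρ x * f x)) x) ^ 2) ≤
      R₀ * Real.sqrt (∑ i, ∑ k, ∫ x,
          (FunctionSpaces.Torus.partialDeriv i (FunctionSpaces.Torus.partialDeriv k f) x) ^ 2) +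
        2 * Real.sqrt (Fintype.card d) * R₁ * Real.sqrt (scalarGradNormSq f) +
        Fintype.card d * R₂ * Real.sqrt (∫ x, f x ^ 2) := by
  have h1c : FunctionSpaces.Torus.IsContDiff 1 ρ := hρ.isContDiff (by simp)
  have h1f : FunctionSpaces.Torus.IsContDiff 1 f := hf.isContDiff (by simp)
  set X : d → d → ℝ := fun i k => Real.sqrt (∫ x, (FunctionSpaces.Torus.partialDeriv i
    (FunctionSpaces.Torus.partialDeriv k (fun x => ρ x * f x)) x) ^ 2) with hX
  set H : d → d → ℝ := fun i k => Real.sqrt (∫ x,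
    (FunctionSpaces.Torus.partialDeriv i (FunctionSpaces.Torus.partialDeriv k f) x) ^ 2) with hH
  set c : d → ℝ := fun k => Real.sqrt (∫ x, (FunctionSpaces.Torus.partialDeriv k f x) ^ 2) with hc
  set b : ℝ := Real.sqrt (∫ x, f x ^ 2) with hb
  -- per-(i,k) bound
  have hXik : ∀ i k, X i k ≤ R₀ * H i k + R₁ * c k + (R₁ * c i + R₂ * b) := by
    intro i k
    have e1 : FunctionSpaces.Torus.partialDeriv k (fun x => ρ x * f x) =
        (fun x => ρ x * FunctionSpaces.Torus.partialDeriv k f x) +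
          fun x => FunctionSpaces.Torus.partialDeriv k ρ x * f x := by
      funext x
      exact FunctionSpaces.Torus.partialDeriv_mul h1c h1f k x
    have sA : FunctionSpaces.Torus.IsSmooth (fun x => ρ x * FunctionSpaces.Torus.partialDeriv k f x) :=
      hρ.smul' (hf.partialDeriv k)
    have sB : FunctionSpaces.Torus.IsSmooth (fun x => FunctionSpaces.Torus.partialDeriv k ρ x * f x) :=
      (hρ.partialDeriv k).smul' hf
    have e' : ∀ x, FunctionSpaces.Torus.partialDeriv i
        (FunctionSpaces.Torus.partialDeriv k (fun x => ρ x * f x)) x =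
        (ρ x * FunctionSpaces.Torus.partialDeriv i (FunctionSpaces.Torus.partialDeriv k f) x +
          FunctionSpaces.Torus.partialDeriv i ρ x * FunctionSpaces.Torus.partialDeriv k f x) +
        (FunctionSpaces.Torus.partialDeriv k ρ x * FunctionSpaces.Torus.partialDeriv i f x +
          FunctionSpaces.Torus.partialDeriv i (FunctionSpaces.Torus.partialDeriv k ρ) x * f x) := by
      intro x
      rw [e1, FunctionSpaces.Torus.partialDeriv_add (sA.isContDiff (by simp)) (sB.isContDiff (by simp)),
        Pi.add_apply,
        FunctionSpaces.Torus.partialDeriv_mul h1c ((hf.partialDeriv k).isContDiff (by simp)) i x,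
        FunctionSpaces.Torus.partialDeriv_mul ((hρ.partialDeriv k).isContDiff (by simp)) h1f i x]
    have cA : Continuous fun x => ρ x * FunctionSpaces.Torus.partialDeriv i (FunctionSpaces.Torus.partialDeriv k f) x :=
      hρ.continuous.mul ((hf.partialDeriv k).partialDeriv i).continuous
    have cB : Continuous fun x => FunctionSpaces.Torus.partialDeriv i ρ x * FunctionSpaces.Torus.partialDeriv k f x :=
      (hρ.partialDeriv i).continuous.mul (hf.partialDeriv k).continuous
    have cC : Continuous fun x => FunctionSpaces.Torus.partialDeriv k ρ x * FunctionSpaces.Torus.partialDeriv i f x :=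
      (hρ.partialDeriv k).continuous.mul (hf.partialDeriv i).continuous
    have cD : Continuous fun x => FunctionSpaces.Torus.partialDeriv i (FunctionSpaces.Torus.partialDeriv k ρ) x * f x :=
      ((hρ.partialDeriv k).partialDeriv i).continuous.mul hf.continuous
    have cAB : Continuous fun x => ρ x * FunctionSpaces.Torus.partialDeriv i
        (FunctionSpaces.Torus.partialDeriv k f) x +
          FunctionSpaces.Torus.partialDeriv i ρ x * FunctionSpaces.Torus.partialDeriv k f x := cA.add cB
    have cCD : Continuous fun x => FunctionSpaces.Torus.partialDeriv k ρ x * FunctionSpaces.Torus.partialDeriv i f x +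
        FunctionSpaces.Torus.partialDeriv i (FunctionSpaces.Torus.partialDeriv k ρ) x * f x := cC.add cD
    have t1 := Torus.sqrt_integral_add_sq_le cAB cCD
    have t2 := Torus.sqrt_integral_add_sq_le cA cB
    have t3 := Torus.sqrt_integral_add_sq_le cC cD
    have bA := sqrt_integral_sq_le_of_abs_le cA ((hf.partialDeriv k).partialDeriv i).continuous hR₀
      (fun x => by rw [abs_mul]; exact mul_le_mul_of_nonneg_right (h0 x) (abs_nonneg _))
    have bB := sqrt_integral_sq_le_of_abs_le cB (hf.partialDeriv k).continuous hR₁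
      (fun x => by rw [abs_mul]; exact mul_le_mul_of_nonneg_right (h1 x i) (abs_nonneg _))
    have bC := sqrt_integral_sq_le_of_abs_le cC (hf.partialDeriv i).continuous hR₁
      (fun x => by rw [abs_mul]; exact mul_le_mul_of_nonneg_right (h1 x k) (abs_nonneg _))
    have bD := sqrt_integral_sq_le_of_abs_le cD hf.continuous hR₂
      (fun x => by rw [abs_mul]; exact mul_le_mul_of_nonneg_right (h2 x i k) (abs_nonneg _))
    have eX : X i k = Real.sqrt (∫ x, ((ρ x * FunctionSpaces.Torus.partialDeriv i
        (FunctionSpaces.Torus.partialDeriv k f) x +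
          FunctionSpaces.Torus.partialDeriv i ρ x * FunctionSpaces.Torus.partialDeriv k f x) +
        (FunctionSpaces.Torus.partialDeriv k ρ x * FunctionSpaces.Torus.partialDeriv i f x +
          FunctionSpaces.Torus.partialDeriv i (FunctionSpaces.Torus.partialDeriv k ρ) x * f x)) ^ 2) := by
      simp only [hX, e']
    rw [eX]
    simp only [hH, hc, hb]
    linarith [t1, t2, t3, bA, bB, bC, bD]
  -- assemble with Minkowski over the double index
  have hX0 : ∀ i k, 0 ≤ X i k := fun i k => Real.sqrt_nonneg _
  have hsumX : Real.sqrt (∑ i, ∑ k, ∫ x, (FunctionSpaces.Torus.partialDeriv i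
      (FunctionSpaces.Torus.partialDeriv k (fun x => ρ x * f x)) x) ^ 2) = Real.sqrt (∑ i, ∑ k, X i k ^ 2) := by
    congr 1
    exact Finset.sum_congr rfl fun i _ => Finset.sum_congr rfl fun k _ =>
      (Real.sq_sqrt (integral_nonneg fun x => sq_nonneg _)).symm
  have hsumH : Real.sqrt (∑ i, ∑ k, ∫ x,
      (FunctionSpaces.Torus.partialDeriv i (FunctionSpaces.Torus.partialDeriv k f) x) ^ 2) =
      Real.sqrt (∑ i, ∑ k, H i k ^ 2) := by
    congr 1
    exact Finset.sum_congr rfl fun i _ => Finset.sum_congr rfl fun k _ =>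
      (Real.sq_sqrt (integral_nonneg fun x => sq_nonneg _)).symm
  have hsumc : Real.sqrt (scalarGradNormSq f) = Real.sqrt (∑ k, c k ^ 2) := by
    rw [IsClassicalScalarTransportForcedOn.scalarGradNormSq_eq_sum hf]
    congr 1
    exact Finset.sum_congr rfl fun k _ => (Real.sq_sqrt (integral_nonneg fun x => sq_nonneg _)).symm
  rw [hsumX, hsumH, hsumc]
  -- flatten the double sums
  have flat : ∀ F : d → d → ℝ, ∑ i, ∑ k, F i k = ∑ p : d × d, F p.1 p.2 := fun F =>
    (Fintype.sum_prod_type' F).symm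
  rw [flat, flat]
  have hc0 : ∀ k, 0 ≤ c k := fun k => Real.sqrt_nonneg _
  have hb0 : 0 ≤ b := Real.sqrt_nonneg _
  have step1 : Real.sqrt (∑ p : d × d, X p.1 p.2 ^ 2) ≤
      Real.sqrt (∑ p : d × d, (R₀ * H p.1 p.2 + R₁ * c p.2 + (R₁ * c p.1 + R₂ * b)) ^ 2) :=
    sqrt_sum_sq_le_sqrt_sum_sq (fun p => hX0 p.1 p.2) (fun p => hXik p.1 p.2)
  have step2 : Real.sqrt (∑ p : d × d, (R₀ * H p.1 p.2 + R₁ * c p.2 + (R₁ * c p.1 + R₂ * b)) ^ 2) ≤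
      Real.sqrt (∑ p : d × d, (R₀ * H p.1 p.2) ^ 2) + Real.sqrt (∑ p : d × d, (R₁ * c p.2) ^ 2) +
        (Real.sqrt (∑ p : d × d, (R₁ * c p.1) ^ 2) + Real.sqrt (∑ _p : d × d, (R₂ * b) ^ 2)) := by
    have m1 := sqrt_sum_sq_add_le (fun p : d × d => R₀ * H p.1 p.2 + R₁ * c p.2)
      (fun p : d × d => R₁ * c p.1 + R₂ * b)
    have m2 := sqrt_sum_sq_add_le (fun p : d × d => R₀ * H p.1 p.2) (fun p : d × d => R₁ * c p.2)
    have m3 := sqrt_sum_sq_add_le (fun p : d × d => R₁ * c p.1) (fun _ : d × d => R₂ * b)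
    linarith [m1, m2, m3]
  -- evaluate the four pieces
  have p1 : Real.sqrt (∑ p : d × d, (R₀ * H p.1 p.2) ^ 2) = R₀ * Real.sqrt (∑ p : d × d, H p.1 p.2 ^ 2) :=
    sqrt_sum_mul_sq (fun p : d × d => H p.1 p.2) hR₀
  have csum : ∑ p : d × d, c p.2 ^ 2 = Fintype.card d * ∑ k, c k ^ 2 := by
    rw [Fintype.sum_prod_type]
    simp only [Finset.sum_const, Finset.card_univ, nsmul_eq_mul]
  have csum' : ∑ p : d × d, c p.1 ^ 2 = Fintype.card d * ∑ k, c k ^ 2 := by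
    rw [Fintype.sum_prod_type]
    simp only [Finset.sum_const, Finset.card_univ, nsmul_eq_mul]
    rw [← Finset.mul_sum]
  have p2 : Real.sqrt (∑ p : d × d, (R₁ * c p.2) ^ 2) =
      Real.sqrt (Fintype.card d) * R₁ * Real.sqrt (∑ k, c k ^ 2) := by
    rw [sqrt_sum_mul_sq (fun p : d × d => c p.2) hR₁, csum, Real.sqrt_mul (Nat.cast_nonneg _)]
    ring
  have p3 : Real.sqrt (∑ p : d × d, (R₁ * c p.1) ^ 2) =
      Real.sqrt (Fintype.card d) * R₁ * Real.sqrt (∑ k, c k ^ 2) := by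
    rw [sqrt_sum_mul_sq (fun p : d × d => c p.1) hR₁, csum', Real.sqrt_mul (Nat.cast_nonneg _)]
    ring
  have p4 : Real.sqrt (∑ _p : d × d, (R₂ * b) ^ 2) = Fintype.card d * (R₂ * b) := by
    rw [sqrt_sum_const_sq (mul_nonneg hR₂ hb0), Fintype.card_prod, Nat.cast_mul,
      Real.sqrt_mul_self (Nat.cast_nonneg _)]
  rw [p1, p2, p3, p4] at step2
  have := step1.trans step2
  rw [hb] at this
  linarith [this]

/-! ### Sources that are sums: triangle inequalities for `‖∇·‖₂` and `(∑‖∂ᵢ∂ₖ·‖₂²)^{1/2}` -/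

open ForcedGradientGrowth in
/-- **`‖∇(f + g)‖₂ ≤ ‖∇f‖₂ + ‖∇g‖₂`** for smooth scalars on `T^d` (Minkowski, componentwise).
[cite: Evans2010, App. B.2 (Minkowski's inequality)] -/
theorem sqrt_scalarGradNormSq_add_le {f g : UnitAddTorus d → ℝ} (hf : FunctionSpaces.Torus.IsSmooth f)
    (hg : FunctionSpaces.Torus.IsSmooth g) :
    Real.sqrt (scalarGradNormSq (fun x => f x + g x)) ≤
      Real.sqrt (scalarGradNormSq f) + Real.sqrt (scalarGradNormSq g) := by
  have hfg : FunctionSpaces.Torus.IsSmooth (fun x => f x + g x) := hf.add hg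
  rw [IsClassicalScalarTransportForcedOn.scalarGradNormSq_eq_sum hfg,
    IsClassicalScalarTransportForcedOn.scalarGradNormSq_eq_sum hf,
    IsClassicalScalarTransportForcedOn.scalarGradNormSq_eq_sum hg]
  set a : d → ℝ := fun k => Real.sqrt (∫ x, (FunctionSpaces.Torus.partialDeriv k (fun x => f x + g x) x) ^ 2)
    with ha
  set b : d → ℝ := fun k => Real.sqrt (∫ x, (FunctionSpaces.Torus.partialDeriv k f x) ^ 2) with hb
  set c : d → ℝ := fun k => Real.sqrt (∫ x, (FunctionSpaces.Torus.partialDeriv k g x) ^ 2) with hc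
  have hak : ∀ k, a k ≤ b k + c k := by
    intro k
    have e' : ∀ x, FunctionSpaces.Torus.partialDeriv k (fun x => f x + g x) x =
        FunctionSpaces.Torus.partialDeriv k f x + FunctionSpaces.Torus.partialDeriv k g x := by
      intro x
      have e1 : (fun x => f x + g x) = f + g := rfl
      rw [e1, FunctionSpaces.Torus.partialDeriv_add (hf.isContDiff (by simp)) (hg.isContDiff (by simp))]
      rfl
    have t := Torus.sqrt_integral_add_sq_le (hf.partialDeriv k).continuous (hg.partialDeriv k).continuous
    have ea : a k = Real.sqrt (∫ x, (FunctionSpaces.Torus.partialDeriv k f x +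
        FunctionSpaces.Torus.partialDeriv k g x) ^ 2) := by
      simp only [ha, e']
    rw [ea]
    simp only [hb, hc]
    exact t
  have e2 : ∀ (z : d → ℝ) (φ : UnitAddTorus d → ℝ),
      (z = fun k => Real.sqrt (∫ x, (FunctionSpaces.Torus.partialDeriv k φ x) ^ 2)) →
      Real.sqrt (∑ k, ∫ x, (FunctionSpaces.Torus.partialDeriv k φ x) ^ 2) = Real.sqrt (∑ k, z k ^ 2) := by
    intro z φ hz
    rw [hz]
    congr 1
    exact Finset.sum_congr rfl fun k _ => (Real.sq_sqrt (integral_nonneg fun x => sq_nonneg _)).symm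
  rw [e2 a _ ha, e2 b _ hb, e2 c _ hc]
  exact (sqrt_sum_sq_le_sqrt_sum_sq (fun k => Real.sqrt_nonneg _) hak).trans (sqrt_sum_sq_add_le b c)

open ForcedGradientGrowth in
/-- **`(∑ᵢₖ‖∂ᵢ∂ₖ(f + g)‖₂²)^{1/2} ≤ (∑ᵢₖ‖∂ᵢ∂ₖf‖₂²)^{1/2} + (∑ᵢₖ‖∂ᵢ∂ₖg‖₂²)^{1/2}`** for smooth scalars
on `T^d` (Minkowski, componentwise). [cite: Evans2010, App. B.2 (Minkowski's inequality)] -/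
theorem sqrt_sum_partialDeriv_partialDeriv_add_sq_le {f g : UnitAddTorus d → ℝ}
    (hf : FunctionSpaces.Torus.IsSmooth f) (hg : FunctionSpaces.Torus.IsSmooth g) :
    Real.sqrt (∑ i, ∑ k, ∫ x, (FunctionSpaces.Torus.partialDeriv i
        (FunctionSpaces.Torus.partialDeriv k (fun x => f x + g x)) x) ^ 2) ≤
      Real.sqrt (∑ i, ∑ k, ∫ x,
          (FunctionSpaces.Torus.partialDeriv i (FunctionSpaces.Torus.partialDeriv k f) x) ^ 2) +
        Real.sqrt (∑ i, ∑ k, ∫ x,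
          (FunctionSpaces.Torus.partialDeriv i (FunctionSpaces.Torus.partialDeriv k g) x) ^ 2) := by
  have e' : ∀ i k x, FunctionSpaces.Torus.partialDeriv i
      (FunctionSpaces.Torus.partialDeriv k (fun x => f x + g x)) x =
      FunctionSpaces.Torus.partialDeriv i (FunctionSpaces.Torus.partialDeriv k f) x +
        FunctionSpaces.Torus.partialDeriv i (FunctionSpaces.Torus.partialDeriv k g) x := by
    intro i k x
    have h1 : (fun x => f x + g x) = f + g := rfl
    rw [h1, FunctionSpaces.Torus.partialDeriv_add (hf.isContDiff (by simp)) (hg.isContDiff (by simp)),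
      FunctionSpaces.Torus.partialDeriv_add ((hf.partialDeriv k).isContDiff (by simp))
        ((hg.partialDeriv k).isContDiff (by simp))]
    rfl
  set A : d × d → ℝ := fun p => Real.sqrt (∫ x, (FunctionSpaces.Torus.partialDeriv p.1
    (FunctionSpaces.Torus.partialDeriv p.2 (fun x => f x + g x)) x) ^ 2) with hA
  set B : d × d → ℝ := fun p => Real.sqrt (∫ x,
    (FunctionSpaces.Torus.partialDeriv p.1 (FunctionSpaces.Torus.partialDeriv p.2 f) x) ^ 2) with hB
  set C : d × d → ℝ := fun p => Real.sqrt (∫ x,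
    (FunctionSpaces.Torus.partialDeriv p.1 (FunctionSpaces.Torus.partialDeriv p.2 g) x) ^ 2) with hC
  have hAp : ∀ p, A p ≤ B p + C p := by
    intro p
    have t := Torus.sqrt_integral_add_sq_le ((hf.partialDeriv p.2).partialDeriv p.1).continuous
      ((hg.partialDeriv p.2).partialDeriv p.1).continuous
    have ea : A p = Real.sqrt (∫ x, (FunctionSpaces.Torus.partialDeriv p.1 (FunctionSpaces.Torus.partialDeriv p.2 f) x +
        FunctionSpaces.Torus.partialDeriv p.1 (FunctionSpaces.Torus.partialDeriv p.2 g) x) ^ 2) := by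
      simp only [hA, e']
    rw [ea]
    simp only [hB, hC]
    exact t
  have flat : ∀ (φ : UnitAddTorus d → ℝ) (Z : d × d → ℝ),
      (Z = fun p => Real.sqrt (∫ x, (FunctionSpaces.Torus.partialDeriv p.1
        (FunctionSpaces.Torus.partialDeriv p.2 φ) x) ^ 2)) →
      Real.sqrt (∑ i, ∑ k, ∫ x, (FunctionSpaces.Torus.partialDeriv i
        (FunctionSpaces.Torus.partialDeriv k φ) x) ^ 2) = Real.sqrt (∑ p : d × d, Z p ^ 2) := by
    intro φ Z hZ
    rw [hZ, ← Fintype.sum_prod_type']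
    congr 1
    exact Finset.sum_congr rfl fun p _ => (Real.sq_sqrt (integral_nonneg fun x => sq_nonneg _)).symm
  rw [flat _ A hA, flat _ B hB, flat _ C hC]
  exact (sqrt_sum_sq_le_sqrt_sum_sq (fun p => Real.sqrt_nonneg _) hAp).trans (sqrt_sum_sq_add_le B C)

end Torus

end Literature.Analysis.FluidPDE
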